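import Mathlib.Analysis.Matrix.Order
import Mathlib.Analysis.Matrix.HermitianFunctionalCalculus
import Mathlib.Analysis.SpecialFunctions.Integrals.Basic
import Mathlib.MeasureTheory.Integral.Pi
import Literature.MathematicalPhysics.QuantumLattice.RationalHybridMonteCarlo
import Literature.Analysis.SpecialFunctions.ComplexGaussianDeterminant
import HarnessLib

/-!
# The twisted-mass quark determinant: no zero modes, Hasenbusch / twisted-mass preconditioning,
# and exact reweighting of the twisted-mass regulator (Lüscher–Palombi)

Topic `MathematicalPhysics/QuantumLattice` (next to `RationalHybridMonteCarlo.lean`, whose matrix-function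
and condition-number vocabulary is reused, and `WilsonQuarkMatrixPositivity.lean`).  PUBLISHED RESULTS,
formalised for one complex `N × N` matrix `D` (a lattice Dirac operator on a fixed gauge field) that is
`γ₅`-Hermitian, `D† = γ₅ D γ₅` with `γ₅† = γ₅`, `γ₅² = 1`, so that `Q = γ₅ D` is Hermitian and `D†D = Q²`:

* R. Frezzotti, P. A. Grassi, S. Sint, P. Weisz, *A local formulation of lattice QCD without unphysical
  fermion zero modes*, Nucl. Phys. B (Proc. Suppl.) 83 (2000) 941 = hep-lat/9909003, §1 eqs. (1.1)–(1.2):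
  "`D_twist = D_W + iμ_q γ₅ τ³` … It is obvious that this lattice Dirac operator is protected against zero
  modes for any finite value of `μ_q`, `det D_twist = det(D_W† D_W + μ_q²) > 0`"; and *Lattice QCD with a
  chirally twisted mass term*, JHEP 08 (2001) 058 = hep-lat/0101001, §1 eq. (1.1): the twisted mass term
  "protects the Dirac operator against zero modes, independently of the background gauge field"
  (§1: `conjTranspose_twistedDirac_mul_self`, `det_twistedDirac_mul_det_twistedDirac_neg`,
  `posDef_tmKernel`, `det_tmKernel_pos`, `spectrum_tmKernel_ge`, `mu_sq_mul_norm_sq_le_re_quadForm_tmKernel`).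
* C. Urbach, K. Jansen, A. Shindler, U. Wenger, Comput. Phys. Commun. 174 (2006) 87 = hep-lat/0506011, §3
  "Mass preconditioning": `det(Q²) = det(W⁺W⁻)·det(Q²)/det(W⁺W⁻)` (first display), "`W± = Q ± iμ`",
  "the operator `diag(W⁺, W⁻) = diag(Q, Q) + iμτ₃` is the two flavor twisted mass operator", "One important
  property of this choice is that `W⁺W⁻ = Q² + μ²`. Note that `(W⁺)† = W⁻`"; M. Hasenbusch, Phys. Lett. B 519
  (2001) 177, §2 (the two-factor split `det M†M ∝ ∫∫ exp(−|M̃⁻¹ψ|²) exp(−|M̃M⁻¹φ|²)`); M. Hasenbusch,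
  K. Jansen, Nucl. Phys. B 659 (2003) 299 = hep-lat/0211042, §2: the twisted-mass version with
  pseudofermion kernels `[Q̂² + ρ²]⁻¹` and `[1 + ρ²Q̂⁻²]`, "the condition number of `Q̂² + ρ²` [is]
  `λ_max/ρ²` … the condition number of the second matrix … becomes `ρ²/λ_min`. This suggests an optimal
  choice `ρ² = √(λ_max λ_min)`", "the condition number `k` of the original action … is reduced to `√k`"
  (§1: `gamma_mul_twistedDirac`; §3: `ratioKernel_mul_tmKernel_zero` (the two factors multiply back),
  `condNumber_tmKernel` = `(λ_max + μ²)/(λ_min + μ²)`, `condNumber_ratioKernel` =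
  `(1 + μ²/λ_min)/(1 + μ²/λ_max)`, their bounds `≤ 1 + λ_max/μ²`, `≤ 1 + μ²/λ_min`,
  `condNumber_tmKernel_mul_condNumber_ratioKernel` — the EXACT form `κ(Q²+μ²)·κ(1+μ²Q⁻²) = κ(Q²)` of the
  two approximate statements —, `condNumber_tmKernel_eq_sqrt`, `condNumber_ratioKernel_eq_sqrt` (both
  `= √κ(Q²)` at `μ² = √(λ_max λ_min)`), `condNumber_inv`).
* M. Lüscher, F. Palombi, *Fluctuations and reweighting of the quark determinant on large lattices*,
  PoS(LATTICE 2008)049 = arXiv:0810.0946 (printed equation numbers of the PoS version): (2.1) "`det(D†D) =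
  W det(D̃†D̃)`", (2.2) "`W_l = det{w_l(D†D)}`", Table 1 (`D̃₁ = D + iμγ₅`, `w₁(ν²) = ν²/(ν²+μ²)`;
  `w₂(ν²) = ν²(ν²+2μ²)/(ν²+μ²)²`; large-`ν` columns `1 − μ²/ν² + O(ν⁻⁴)`, `1 − μ⁴/ν⁴ + O(ν⁻⁶)`), "The modified
  quark determinant `det(D̃₁†D̃₁)` in fact coincides with the quark determinant in twisted-mass QCD";
  (3.2) "`W_l = e^{−X_l}`, `X_l = ∫₀^{μ²} ds₁…ds_l Tr{(D†D + s₁ + … + s_l)^{−l}}`"; (6.1)–(6.2) the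
  pseudofermion estimator "`W_{l,N} = (1/N) Σ_k exp{(η_k, [1 − w_l(D†D)⁻¹] η_k)}` … This procedure is
  correct for any `N ≥ 1`" (§2: `w₁`, `w₂`, `one_sub_w₁`/`one_sub_w₂` (the large-`ν` columns, exactly),
  `rwFactor₁`, `rwFactor₂`, `rwFactor₁_eq_prod`/`rwFactor₂_eq_prod` (= (2.2)), `det_cfc_w₁`/`det_cfc_w₂`,
  `0 ≤ W₁ ≤ W₂ ≤ 1`, `det_eq_rwFactor₁_mul_det`/`det_eq_rwFactor₂_mul` (= (2.1)); §4: `integral_rwEstimator`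
  (one sample of (6.2) is unbiased for `det w(D†D)`, any admissible `w`), `rwEstimator_le_one` (each sample
  lies in `(0,1]`), `integral_rwEstimator₁`, `integral_rwEstimator₁_sq`, `variance_rwEstimator₁`; §5:
  `rwExponent₁`, `rwExponent₂`, `exp_neg_rwExponent₁`, `exp_neg_rwExponent₂` (= (3.2) for `l = 1, 2`)).

HONEST SCOPE. One matrix at a time (one gauge configuration): nothing about Markov chains, molecular
dynamics forces, ensembles, the size of fluctuations of `W_l` over gauge fields (LP §§3–5 are NOT
formalised), or O(a) improvement; "condition number" is the spectral one `λ_max/λ_min` of the tree's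
`RHMC.condNumber`; the two-flavour doublet is handled as the PRODUCT of the determinants of its two
components `D ± iμγ₅` (the flavour-diagonal block structure is not re-typed); `W₁`, `W₂` are defined as
the determinant ratios of (2.1) and PROVED equal to `det{w_l(D†D)}` (2.2); the `l = 2` modified operator
`D̃₂` of Table 1 enters only through `det(D̃₂†D̃₂) = det(D†D + μ²)²/det(D†D + 2μ²)`.  The instance for the
tree's Wilson–Dirac operator `wilsonDirac ρ U m r` (γ₅-hermiticity `wilsonDirac_gammaFive_hermitian_holds`,
file `GrassmannIntegralWilsonProofs.lean`) is left to a sequel file.  Cell pub-lqcd (venture `LatticeQCDFlow`): HOME/R2-SCOPE.md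
§3 E3 (positivity of the `N_f = 2` twisted-mass targets of §2 P8/P8′), §3 E4 ("a regulator `(DD† + μ₀)` …
left in the accept step changes the target" — here by exactly the factor `W₁ = det[D†D/(D†D + μ₀)]`), §4
(solve cost classes: condition numbers of the Hasenbusch factors), FANOUT row 38.  No named fact is
introduced (D-0026).

## References
* [FrezzottiEtAl2000ZeroModes] R. Frezzotti, P. A. Grassi, S. Sint, P. Weisz, Nucl. Phys. B (Proc. Suppl.)
  83 (2000) 941, §1 (1.1)–(1.2).
* [FrezzottiEtAl2001tmQCD] R. Frezzotti, P. A. Grassi, S. Sint, P. Weisz, JHEP 08 (2001) 058, §1 (1.1).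
* [UrbachEtAl2006] C. Urbach, K. Jansen, A. Shindler, U. Wenger, Comput. Phys. Commun. 174 (2006) 87, §3.
* [Hasenbusch2001] M. Hasenbusch, Phys. Lett. B 519 (2001) 177, §2.
* [HasenbuschJansen2003] M. Hasenbusch, K. Jansen, Nucl. Phys. B 659 (2003) 299, §2.
* [LuscherPalombi2008] M. Lüscher, F. Palombi, PoS(LATTICE 2008)049, (2.1)–(2.2), Table 1, (3.2),
  (6.1)–(6.2).
* [AltlandSimons2010] A. Altland, B. D. Simons, Condensed Matter Field Theory, CUP 2010, §3.2 (3.17) (the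
  complex Gaussian integral, through `Literature.Analysis.SpecialFunctions.ComplexGaussianDeterminant`).
* [GolubVanLoan2013] G. H. Golub, C. F. Van Loan, Matrix Computations, 4th ed., §9.1 Cor. 9.1.3 (9.1.9)
  (`f(A) = U diag f(λᵢ) U†`, through `RationalHybridMonteCarlo.lean`).
-/

namespace Literature.MathematicalPhysics.QuantumLattice.TwistedMass

open Matrix MeasureTheory Literature.Analysis.SpecialFunctions
  Literature.MathematicalPhysics.QuantumLattice.RHMC
open scoped MatrixOrder ComplexOrder BigOperators

variable {ι : Type} [Fintype ι] [DecidableEq ι]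

/-! ## §1 `γ₅`-hermiticity, the twisted-mass operator `D + iμγ₅`, and the absence of zero modes -/

section GammaFive

variable {γ D : Matrix ι ι ℂ}

/-- The Hermitian Dirac operator `Q = γ₅ D` (Urbach et al. §2/§3; Lüscher–Palombi §2 "the hermitian Dirac
operator `γ₅D`"). [cite: UrbachEtAl2006, §3 (W± = Q ± iμ with Q = γ₅ D)] -/
def hermQ (γ D : Matrix ι ι ℂ) : Matrix ι ι ℂ := γ * D

omit [DecidableEq ι] in
/-- Unfolding lemma for `hermQ`. [cite: UrbachEtAl2006, §3] -/
theorem hermQ_def (γ D : Matrix ι ι ℂ) : hermQ γ D = γ * D := rfl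

/-- **`Q = γ₅D` is Hermitian** for a `γ₅`-Hermitian `D` (`D† = γ₅Dγ₅`, `γ₅† = γ₅`, `γ₅² = 1`).
[cite: UrbachEtAl2006, §3 ('(W⁺)† = W⁻' at μ = 0)] -/
theorem isHermitian_hermQ (hγ : γᴴ = γ) (hγγ : γ * γ = 1) (hD : Dᴴ = γ * D * γ) :
    (hermQ γ D).IsHermitian := by
  unfold Matrix.IsHermitian hermQ
  rw [conjTranspose_mul, hD, hγ, Matrix.mul_assoc, Matrix.mul_assoc, hγγ, Matrix.mul_one]

omit [DecidableEq ι] in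
/-- **`D†D = Q²`** for a `γ₅`-Hermitian `D`: the two-flavour Wilson determinant `det(D†D)` is `det Q²`.
[cite: UrbachEtAl2006, §3 (first display, det(Q²))] -/
theorem conjTranspose_mul_self_eq_hermQ_sq (hD : Dᴴ = γ * D * γ) :
    Dᴴ * D = hermQ γ D * hermQ γ D := by
  rw [hD, hermQ, Matrix.mul_assoc]

/-- **The twisted-mass Dirac operator** (one flavour component of the doublet): `D + iμγ₅`
(FGSW (1.1) `D_twist = D_W + iμ_q γ₅τ³`, upper component; the lower component is `twistedDirac γ D (−μ)`;
Lüscher–Palombi Table 1 `D̃₁ = D + iμγ₅`). [cite: FrezzottiEtAl2000ZeroModes, §1 eq. (1.1)]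
[cite: LuscherPalombi2008, Table 1 (D̃₁ = D + iμγ₅)] -/
def twistedDirac (γ D : Matrix ι ι ℂ) (μ : ℝ) : Matrix ι ι ℂ := D + ((μ : ℂ) * Complex.I) • γ

omit [Fintype ι] [DecidableEq ι] in
/-- Unfolding lemma for `twistedDirac`. [cite: FrezzottiEtAl2000ZeroModes, §1 eq. (1.1)] -/
theorem twistedDirac_def (γ D : Matrix ι ι ℂ) (μ : ℝ) :
    twistedDirac γ D μ = D + ((μ : ℂ) * Complex.I) • γ := rfl

/-- **`γ₅(D + iμγ₅) = Q + iμ`** — Urbach et al.'s preconditioner `W⁺ = Q + iμ` is `γ₅` times the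
twisted-mass operator (and `W⁻ = γ₅(D − iμγ₅)`). [cite: UrbachEtAl2006, §3 (W± = Q ± iμ; §4 W±_j = γ₅(D_W ± iμ_jγ₅))] -/
theorem gamma_mul_twistedDirac (hγγ : γ * γ = 1) (μ : ℝ) :
    γ * twistedDirac γ D μ = hermQ γ D + ((μ : ℂ) * Complex.I) • (1 : Matrix ι ι ℂ) := by
  rw [twistedDirac, hermQ, Matrix.mul_add, Matrix.mul_smul, hγγ]

/-- **`(D + iμγ₅)† = γ₅ (D − iμγ₅) γ₅`**: the adjoint of one flavour component is `γ₅`-conjugate to the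
other ("`(W⁺)† = W⁻`"). [cite: UrbachEtAl2006, §3 ('(W⁺)† = W⁻')] -/
theorem conjTranspose_twistedDirac (hγ : γᴴ = γ) (hγγ : γ * γ = 1) (hD : Dᴴ = γ * D * γ) (μ : ℝ) :
    (twistedDirac γ D μ)ᴴ = γ * twistedDirac γ D (-μ) * γ := by
  have hc : star ((μ : ℂ) * Complex.I) = (((-μ : ℝ) : ℂ) * Complex.I) := by
    rw [star_mul', Complex.star_def, Complex.conj_I, Complex.conj_ofReal,
      Complex.ofReal_neg]; ring
  rw [twistedDirac, twistedDirac, conjTranspose_add, conjTranspose_smul, hD, hγ, hc, Matrix.mul_add,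
    Matrix.mul_smul, hγγ, Matrix.add_mul, Matrix.smul_mul, Matrix.one_mul]

/-- **`(D + iμγ₅)†(D + iμγ₅) = D†D + μ²`** — "One important property of this choice is that
`W⁺W⁻ = Q² + μ²`" (Urbach et al. §3); "The modified quark determinant `det(D̃₁†D̃₁)` in fact coincides
with the quark determinant in twisted-mass QCD" (Lüscher–Palombi §2): the cross terms `iμ(D†γ₅ − γ₅D)`
cancel by `γ₅`-hermiticity. [cite: UrbachEtAl2006, §3 ('W⁺W⁻ = Q² + μ²')]
[cite: LuscherPalombi2008, §2 (after (2.2))] -/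
theorem conjTranspose_twistedDirac_mul_self (hγ : γᴴ = γ) (hγγ : γ * γ = 1) (hD : Dᴴ = γ * D * γ)
    (μ : ℝ) :
    (twistedDirac γ D μ)ᴴ * twistedDirac γ D μ = Dᴴ * D + ((μ ^ 2 : ℝ) : ℂ) • (1 : Matrix ι ι ℂ) := by
  have hDγ : Dᴴ * γ = γ * D := by rw [hD, Matrix.mul_assoc, hγγ, Matrix.mul_one]
  have hc : star ((μ : ℂ) * Complex.I) = -((μ : ℂ) * Complex.I) := by
    rw [star_mul', Complex.star_def, Complex.conj_I, Complex.conj_ofReal]; ring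
  have hcc : -((μ : ℂ) * Complex.I) * ((μ : ℂ) * Complex.I) = ((μ ^ 2 : ℝ) : ℂ) := by
    rw [Complex.ofReal_pow, show -((μ : ℂ) * Complex.I) * ((μ : ℂ) * Complex.I) =
      -((μ : ℂ) ^ 2 * (Complex.I * Complex.I)) by ring, Complex.I_mul_I]; ring
  rw [twistedDirac, conjTranspose_add, conjTranspose_smul, hγ, hc, Matrix.add_mul, Matrix.mul_add,
    Matrix.mul_add, Matrix.smul_mul, Matrix.smul_mul, Matrix.mul_smul, Matrix.mul_smul, smul_smul, hγγ,
    hDγ, hcc, neg_smul, add_assoc, add_neg_cancel_left]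

/-- **`det(D − iμγ₅) = (det(D + iμγ₅))*`**: the two flavour components have complex-conjugate
determinants (from `(D + iμγ₅)† = γ₅(D − iμγ₅)γ₅` and `det γ₅² = 1`).
[cite: FrezzottiEtAl2000ZeroModes, §1 eq. (1.2)] -/
theorem det_twistedDirac_neg (hγ : γᴴ = γ) (hγγ : γ * γ = 1) (hD : Dᴴ = γ * D * γ) (μ : ℝ) :
    (twistedDirac γ D (-μ)).det = star (twistedDirac γ D μ).det := by
  have h := congrArg Matrix.det (conjTranspose_twistedDirac hγ hγγ hD μ)
  rw [det_conjTranspose, det_mul, det_mul] at h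
  have hdet : γ.det * γ.det = 1 := by rw [← det_mul, hγγ, det_one]
  rw [h, mul_comm γ.det (twistedDirac γ D (-μ)).det, mul_assoc, hdet, mul_one]

/-- **FGSW (1.2): the determinant of the twisted doublet is `det(D†D + μ²)`** —
`det(D + iμγ₅) · det(D − iμγ₅) = det(D†D + μ²)` ("`det D_twist = det(D_W†D_W + μ_q²)`"; the doublet
`D_W + iμ_qγ₅τ³` is block diagonal in flavour with blocks `D_W ± iμ_qγ₅`).
[cite: FrezzottiEtAl2000ZeroModes, §1 eq. (1.2)] [cite: UrbachEtAl2006, §3 ('W⁺W⁻ = Q² + μ²')] -/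
theorem det_twistedDirac_mul_det_twistedDirac_neg (hγ : γᴴ = γ) (hγγ : γ * γ = 1)
    (hD : Dᴴ = γ * D * γ) (μ : ℝ) :
    (twistedDirac γ D μ).det * (twistedDirac γ D (-μ)).det =
      (Dᴴ * D + ((μ ^ 2 : ℝ) : ℂ) • (1 : Matrix ι ι ℂ)).det := by
  rw [← conjTranspose_twistedDirac_mul_self hγ hγγ hD μ, det_mul, det_conjTranspose,
    det_twistedDirac_neg hγ hγγ hD μ, mul_comm]

/-- **The doublet determinant is `|det(D + iμγ₅)|²`**, in particular real and non-negative.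
[cite: FrezzottiEtAl2000ZeroModes, §1 eq. (1.2)] -/
theorem det_twistedDirac_mul_det_twistedDirac_neg_eq_normSq (hγ : γᴴ = γ) (hγγ : γ * γ = 1)
    (hD : Dᴴ = γ * D * γ) (μ : ℝ) :
    (twistedDirac γ D μ).det * (twistedDirac γ D (-μ)).det =
      ((Complex.normSq (twistedDirac γ D μ).det : ℝ) : ℂ) := by
  rw [det_twistedDirac_neg hγ hγγ hD μ, Complex.star_def, Complex.mul_conj]

end GammaFive

/-! ### The twisted-mass kernel `D†D + μ²` is positive definite with spectral gap `μ²` (any `D`) -/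

section Kernel

variable {D : Matrix ι ι ℂ}

/-- The **twisted-mass kernel** `ℳ_μ = D†D + μ²` (`= W⁺W⁻ = Q² + μ²` for `γ₅`-Hermitian `D`,
`conjTranspose_twistedDirac_mul_self`; the operator whose determinant the modified HMC of
Lüscher–Palombi includes, Table 1, `l = 1`). [cite: LuscherPalombi2008, Table 1 (l = 1)]
[cite: UrbachEtAl2006, §3 ('W⁺W⁻ = Q² + μ²')] -/
def tmKernel (D : Matrix ι ι ℂ) (μ : ℝ) : Matrix ι ι ℂ := Dᴴ * D + ((μ ^ 2 : ℝ) : ℂ) • (1 : Matrix ι ι ℂ)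

/-- Unfolding lemma for `tmKernel`. [cite: LuscherPalombi2008, Table 1 (l = 1)] -/
theorem tmKernel_def (D : Matrix ι ι ℂ) (μ : ℝ) :
    tmKernel D μ = Dᴴ * D + ((μ ^ 2 : ℝ) : ℂ) • (1 : Matrix ι ι ℂ) := rfl

/-- `ℳ_0 = D†D`. [cite: LuscherPalombi2008, eq. (2.1)] -/
theorem tmKernel_zero (D : Matrix ι ι ℂ) : tmKernel D 0 = Dᴴ * D := by
  rw [tmKernel, sq, mul_zero, Complex.ofReal_zero, zero_smul, add_zero]

/-- `ℳ_μ` only depends on `μ²`: `ℳ_{−μ} = ℳ_μ`. [cite: FrezzottiEtAl2000ZeroModes, §1 eq. (1.2)] -/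
theorem tmKernel_neg (D : Matrix ι ι ℂ) (μ : ℝ) : tmKernel D (-μ) = tmKernel D μ := by
  rw [tmKernel, tmKernel, neg_sq]

/-- `D†D` is positive semidefinite (Mathlib), recorded in this file's notation.
[cite: FrezzottiEtAl2000ZeroModes, §1 eq. (1.2)] -/
theorem posSemidef_tmKernel_zero (D : Matrix ι ι ℂ) : (tmKernel D 0).PosSemidef := by
  rw [tmKernel_zero]; exact posSemidef_conjTranspose_mul_self D

/-- `ℳ_μ` is Hermitian. [cite: LuscherPalombi2008, Table 1 (l = 1)] -/
theorem isHermitian_tmKernel (D : Matrix ι ι ℂ) (μ : ℝ) : (tmKernel D μ).IsHermitian := by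
  unfold tmKernel Matrix.IsHermitian
  rw [conjTranspose_add, conjTranspose_mul, conjTranspose_conjTranspose, conjTranspose_smul,
    conjTranspose_one, Complex.star_def, Complex.conj_ofReal]

/-- `ℳ_μ` is positive semidefinite for every real `μ`. [cite: FrezzottiEtAl2000ZeroModes, §1 eq. (1.2)] -/
theorem posSemidef_tmKernel (D : Matrix ι ι ℂ) (μ : ℝ) : (tmKernel D μ).PosSemidef :=
  (posSemidef_conjTranspose_mul_self D).add
    (Matrix.PosSemidef.one.smul (Complex.zero_le_real.mpr (sq_nonneg μ)))

/-- **"protected against zero modes for any finite value of `μ_q`"**: `ℳ_μ = D†D + μ²` is positive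
DEFINITE for `μ ≠ 0`, for EVERY matrix `D` ("independently of the background gauge field").
[cite: FrezzottiEtAl2000ZeroModes, §1 eq. (1.2)] [cite: FrezzottiEtAl2001tmQCD, §1 eq. (1.1)] -/
theorem posDef_tmKernel (D : Matrix ι ι ℂ) {μ : ℝ} (hμ : μ ≠ 0) : (tmKernel D μ).PosDef := by
  have hμ2 : (0 : ℂ) < ((μ ^ 2 : ℝ) : ℂ) := Complex.zero_lt_real.mpr (by positivity)
  rw [tmKernel, add_comm]
  exact (Matrix.PosDef.one.smul hμ2).add_posSemidef (posSemidef_conjTranspose_mul_self D)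

/-- `ℳ_0 = D†D` is positive definite as soon as `D` is invertible. [cite: LuscherPalombi2008, eq. (2.1)] -/
theorem posDef_tmKernel_zero (hD : IsUnit D.det) : (tmKernel D 0).PosDef := by
  rw [tmKernel_zero]
  refine Matrix.PosDef.conjTranspose_mul_self D ?_
  rw [← Matrix.isUnit_iff_isUnit_det] at hD
  exact fun v w h => (Matrix.mulVec_injective_of_isUnit hD) h

/-- **FGSW (1.2): `det(D†D + μ²) > 0`** for `μ ≠ 0` and every `D` — the determinant of the twisted
doublet is a positive real. [cite: FrezzottiEtAl2000ZeroModes, §1 eq. (1.2)] -/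
theorem det_tmKernel_pos (D : Matrix ι ι ℂ) {μ : ℝ} (hμ : μ ≠ 0) :
    0 < (tmKernel D μ).det.re ∧ (tmKernel D μ).det.im = 0 := by
  have h := (posDef_tmKernel D hμ).det_pos
  rw [Complex.lt_def] at h
  exact ⟨by simpa using h.1, by simpa using h.2.symm⟩

/-- `det ℳ_μ` is a non-negative real for every `μ` (and `= |det D|²` at `μ = 0`).
[cite: FrezzottiEtAl2000ZeroModes, §1 eq. (1.2)] -/
theorem det_tmKernel_nonneg (D : Matrix ι ι ℂ) (μ : ℝ) :
    0 ≤ (tmKernel D μ).det.re ∧ (tmKernel D μ).det.im = 0 := by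
  have h := (posSemidef_tmKernel D μ).det_nonneg
  rw [Complex.le_def] at h
  exact ⟨by simpa using h.1, by simpa using h.2.symm⟩

/-- `det(D†D) = |det D|²` (real part form). [cite: LuscherPalombi2008, eq. (2.1)] -/
theorem det_tmKernel_zero_re (D : Matrix ι ι ℂ) : (tmKernel D 0).det.re = ‖D.det‖ ^ 2 := by
  rw [tmKernel_zero]; exact re_det_conjTranspose_mul_self D

/-- The shifted kernel is the continuous functional calculus of `x ↦ x + μ²` at `D†D` (private helper).
[folklore] -/
private theorem tmKernel_eq_cfc (D : Matrix ι ι ℂ) (μ : ℝ) :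
    tmKernel D μ = cfc (fun x : ℝ => x + μ ^ 2) (tmKernel D 0) := by
  have h0 := isHermitian_tmKernel D 0
  rw [cfc_add_const (μ ^ 2) (fun x : ℝ => x) (tmKernel D 0)
      ((Matrix.finite_real_spectrum (A := tmKernel D 0)).continuousOn _) h0.isSelfAdjoint,
    cfc_id' ℝ (tmKernel D 0) h0.isSelfAdjoint, Algebra.algebraMap_eq_smul_one,
    RCLike.real_smul_eq_coe_smul (K := ℂ), tmKernel_zero, tmKernel]
  rfl

/-- **Spectral mapping for the twisted-mass shift**: `spec(D†D + μ²) = spec(D†D) + μ²`.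
[cite: HasenbuschJansen2003, §2 ('the condition number of Q̂² + ρ²')] -/
theorem spectrum_tmKernel (D : Matrix ι ι ℂ) (μ : ℝ) :
    spectrum ℝ (tmKernel D μ) = (fun x : ℝ => x + μ ^ 2) '' spectrum ℝ (tmKernel D 0) := by
  rw [tmKernel_eq_cfc D μ]
  exact cfc_map_spectrum (fun x : ℝ => x + μ ^ 2) (tmKernel D 0) (isHermitian_tmKernel D 0).isSelfAdjoint
    ((Matrix.finite_real_spectrum (A := tmKernel D 0)).continuousOn _)

/-- The spectrum of `D†D` is non-negative (private helper). [folklore] -/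
private theorem spectrum_tmKernel_zero_nonneg (D : Matrix ι ι ℂ) {x : ℝ}
    (hx : x ∈ spectrum ℝ (tmKernel D 0)) : 0 ≤ x := by
  rw [(isHermitian_tmKernel D 0).spectrum_real_eq_range_eigenvalues] at hx
  obtain ⟨i, rfl⟩ := hx
  exact (posSemidef_tmKernel_zero D).eigenvalues_nonneg i

/-- **The spectral gap `μ²`**: every eigenvalue of `D†D + μ²` is `≥ μ²` — "protects the Dirac operator
against zero modes, independently of the background gauge field" (FGSW 2001 §1); "the spectrum of `γ₅D̃_l`
is … rigorously separated from the origin by a distance of order `μ`, for all quark masses" (LP §2).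
[cite: FrezzottiEtAl2001tmQCD, §1 eq. (1.1)] [cite: LuscherPalombi2008, §2 (after (2.2))] -/
theorem spectrum_tmKernel_ge (D : Matrix ι ι ℂ) (μ : ℝ) {x : ℝ} (hx : x ∈ spectrum ℝ (tmKernel D μ)) :
    μ ^ 2 ≤ x := by
  rw [spectrum_tmKernel] at hx
  obtain ⟨y, hy, rfl⟩ := hx
  exact le_add_of_nonneg_left (spectrum_tmKernel_zero_nonneg D hy)

/-- The gap in quadratic-form language: `μ²‖v‖² ≤ Re v†(D†D + μ²)v = ‖Dv‖² + μ²‖v‖²` for every `v`.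
[cite: FrezzottiEtAl2001tmQCD, §1 eq. (1.1)] -/
theorem re_quadForm_tmKernel (D : Matrix ι ι ℂ) (μ : ℝ) (v : ι → ℂ) :
    (star v ⬝ᵥ tmKernel D μ *ᵥ v).re = ∑ i, ‖(D *ᵥ v) i‖ ^ 2 + μ ^ 2 * ∑ i, ‖v i‖ ^ 2 := by
  have h1 : (star v ⬝ᵥ (((μ ^ 2 : ℝ) : ℂ) • (1 : Matrix ι ι ℂ)) *ᵥ v).re = μ ^ 2 * ∑ i, ‖v i‖ ^ 2 := by
    rw [Matrix.smul_mulVec, one_mulVec, dotProduct_smul, smul_eq_mul, Complex.re_ofReal_mul]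
    congr 1
    have h := re_star_dotProduct_conjTranspose_mul_self_mulVec (1 : Matrix ι ι ℂ) v
    rwa [conjTranspose_one, Matrix.mul_one, one_mulVec] at h
  rw [tmKernel, add_mulVec, dotProduct_add, Complex.add_re,
    re_star_dotProduct_conjTranspose_mul_self_mulVec D v, h1]

/-- Consequently `μ²‖v‖² ≤ Re v†(D†D + μ²)v`: no vector is annihilated by more than the gap allows.
[cite: FrezzottiEtAl2001tmQCD, §1 eq. (1.1)] -/
theorem mu_sq_mul_norm_sq_le_re_quadForm_tmKernel (D : Matrix ι ι ℂ) (μ : ℝ) (v : ι → ℂ) :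
    μ ^ 2 * ∑ i, ‖v i‖ ^ 2 ≤ (star v ⬝ᵥ tmKernel D μ *ᵥ v).re := by
  rw [re_quadForm_tmKernel]
  exact le_add_of_nonneg_left (Finset.sum_nonneg fun i _ => sq_nonneg _)

end Kernel

/-! ## §2 The Lüscher–Palombi reweighting factors `W₁`, `W₂` (Table 1) -/

section ReweightingFactors

/-- `w₁(t) = t/(t + μ²)` — the spectral function of the first reweighting factor,
`W₁ = det{w₁(D†D)}` (Table 1, `l = 1`). [cite: LuscherPalombi2008, Table 1 (l = 1) and eq. (2.2)] -/
noncomputable def w₁ (μ t : ℝ) : ℝ := t / (t + μ ^ 2)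

/-- `w₂(t) = t(t + 2μ²)/(t + μ²)²` — the spectral function of the second reweighting factor
(Table 1, `l = 2`). [cite: LuscherPalombi2008, Table 1 (l = 2) and eq. (2.2)] -/
noncomputable def w₂ (μ t : ℝ) : ℝ := t * (t + 2 * μ ^ 2) / (t + μ ^ 2) ^ 2

/-- Unfolding lemma for `w₁`. [cite: LuscherPalombi2008, Table 1 (l = 1)] -/
theorem w₁_def (μ t : ℝ) : w₁ μ t = t / (t + μ ^ 2) := rfl

/-- Unfolding lemma for `w₂`. [cite: LuscherPalombi2008, Table 1 (l = 2)] -/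
theorem w₂_def (μ t : ℝ) : w₂ μ t = t * (t + 2 * μ ^ 2) / (t + μ ^ 2) ^ 2 := rfl

/-- **Table 1, last column, `l = 1`, exactly**: `1 − w₁(ν²) = μ²/(ν² + μ²)` (printed as the asymptotics
`w₁ = 1 − μ²/ν² + O(ν⁻⁴)`). [cite: LuscherPalombi2008, Table 1 (l = 1, column ν² ≫ μ²)] -/
theorem one_sub_w₁ {μ t : ℝ} (h : t + μ ^ 2 ≠ 0) : 1 - w₁ μ t = μ ^ 2 / (t + μ ^ 2) := by
  rw [w₁, eq_div_iff h, sub_mul, div_mul_cancel₀ _ h]; ring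

/-- **Table 1, last column, `l = 2`, exactly**: `1 − w₂(ν²) = μ⁴/(ν² + μ²)²` (printed as
`w₂ = 1 − μ⁴/ν⁴ + O(ν⁻⁶)`: the second factorisation suppresses the high modes by a further factor `μ²/ν²`).
[cite: LuscherPalombi2008, Table 1 (l = 2, column ν² ≫ μ²) and §4 ('a second suppression factor')] -/
theorem one_sub_w₂ {μ t : ℝ} (h : t + μ ^ 2 ≠ 0) : 1 - w₂ μ t = (μ ^ 2 / (t + μ ^ 2)) ^ 2 := by
  have h2 : (t + μ ^ 2) ^ 2 ≠ 0 := pow_ne_zero 2 h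
  rw [w₂, div_pow, eq_div_iff h2, sub_mul, div_mul_cancel₀ _ h2]; ring

/-- `w₂ = 1 − (1 − w₁)² = w₁(2 − w₁)`: the second factor is the first with its defect squared.
[cite: LuscherPalombi2008, Table 1] -/
theorem w₂_eq_of_w₁ {μ t : ℝ} (h : t + μ ^ 2 ≠ 0) : w₂ μ t = w₁ μ t * (2 - w₁ μ t) := by
  have e1 := one_sub_w₁ (μ := μ) h
  have e2 := one_sub_w₂ (μ := μ) h
  have hw2 : w₂ μ t = 1 - (1 - w₁ μ t) ^ 2 := by rw [e1, ← e2]; ring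
  rw [hw2]; ring

/-- `0 ≤ w₁(t)` for `t ≥ 0`. [cite: LuscherPalombi2008, Table 1 (l = 1)] -/
theorem w₁_nonneg (μ : ℝ) {t : ℝ} (ht : 0 ≤ t) : 0 ≤ w₁ μ t :=
  div_nonneg ht (by positivity)

/-- `w₁(t) ≤ 1` for `t ≥ 0`: the reweighting factor never exceeds one. [cite: LuscherPalombi2008, Table 1 (l = 1)] -/
theorem w₁_le_one (μ : ℝ) {t : ℝ} (ht : 0 ≤ t) : w₁ μ t ≤ 1 := by
  rcases (add_nonneg ht (sq_nonneg μ)).eq_or_lt with h | h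
  · rw [w₁, ← h, div_zero]; exact zero_le_one
  · rw [w₁, div_le_one h]; nlinarith [sq_nonneg μ]

/-- `0 < w₁(t)` for `t > 0`. [cite: LuscherPalombi2008, Table 1 (l = 1)] -/
theorem w₁_pos (μ : ℝ) {t : ℝ} (ht : 0 < t) : 0 < w₁ μ t :=
  div_pos ht (by positivity)

/-- `w₁(t) < 1` for `t ≥ 0` and `μ ≠ 0`. [cite: LuscherPalombi2008, Table 1 (l = 1)] -/
theorem w₁_lt_one {μ : ℝ} (hμ : μ ≠ 0) {t : ℝ} (ht : 0 ≤ t) : w₁ μ t < 1 := by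
  have h : 0 < t + μ ^ 2 := by positivity
  rw [w₁, div_lt_one h]; exact lt_add_of_pos_right t (by positivity)

/-- `w₁ ≤ w₂ ≤ 1` for `t ≥ 0` (first half): the second factorisation reweights by less.
[cite: LuscherPalombi2008, Table 1 and §4 ('a second suppression factor')] -/
theorem w₁_le_w₂ (μ : ℝ) {t : ℝ} (ht : 0 ≤ t) : w₁ μ t ≤ w₂ μ t := by
  rcases (add_nonneg ht (sq_nonneg μ)).eq_or_lt with h | h
  · rw [w₁, w₂, ← h, div_zero, zero_pow two_ne_zero, div_zero]
  · rw [w₂_eq_of_w₁ h.ne']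
    have h1 := w₁_le_one μ ht
    have h0 := w₁_nonneg μ ht
    nlinarith

/-- `w₂(t) ≤ 1` for `t ≥ 0`. [cite: LuscherPalombi2008, Table 1 (l = 2)] -/
theorem w₂_le_one (μ : ℝ) {t : ℝ} (ht : 0 ≤ t) : w₂ μ t ≤ 1 := by
  rcases (add_nonneg ht (sq_nonneg μ)).eq_or_lt with h | h
  · rw [w₂, ← h, zero_pow two_ne_zero, div_zero]; exact zero_le_one
  · rw [← sub_nonneg, one_sub_w₂ h.ne']; positivity

/-- `0 ≤ w₂(t)` for `t ≥ 0`. [cite: LuscherPalombi2008, Table 1 (l = 2)] -/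
theorem w₂_nonneg (μ : ℝ) {t : ℝ} (ht : 0 ≤ t) : 0 ≤ w₂ μ t :=
  (w₁_nonneg μ ht).trans (w₁_le_w₂ μ ht)

/-- `0 < w₂(t)` for `t > 0`. [cite: LuscherPalombi2008, Table 1 (l = 2)] -/
theorem w₂_pos (μ : ℝ) {t : ℝ} (ht : 0 < t) : 0 < w₂ μ t :=
  (w₁_pos μ ht).trans_le (w₁_le_w₂ μ ht.le)

variable {D : Matrix ι ι ℂ}

/-- `D†D + 2μ² = ℳ_{√2 μ}` (the second shift of Table 1, `l = 2`). [cite: LuscherPalombi2008, Table 1 (l = 2)] -/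
theorem tmKernel_sqrt_two_mul (D : Matrix ι ι ℂ) (μ : ℝ) :
    tmKernel D (Real.sqrt 2 * μ) = Dᴴ * D + ((2 * μ ^ 2 : ℝ) : ℂ) • (1 : Matrix ι ι ℂ) := by
  rw [tmKernel, mul_pow, Real.sq_sqrt zero_le_two]

/-- **`det(D†D + μ²) = ∏ᵢ (λᵢ + μ²)`** over the eigenvalues `λᵢ ≥ 0` of `D†D`.
[cite: LuscherPalombi2008, eq. (2.2) (W_l = det{w_l(D†D)} evaluated on the spectrum)] -/
theorem det_tmKernel_eq_prod (D : Matrix ι ι ℂ) (μ : ℝ) :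
    (tmKernel D μ).det = ∏ i, (((isHermitian_tmKernel D 0).eigenvalues i + μ ^ 2 : ℝ) : ℂ) := by
  rw [tmKernel_eq_cfc D μ, det_cfc (isHermitian_tmKernel D 0)]

/-- Real-part form: `det(D†D + μ²) = ∏ᵢ (λᵢ + μ²)` as a real number. [cite: LuscherPalombi2008, eq. (2.2)] -/
theorem det_tmKernel_re_eq_prod (D : Matrix ι ι ℂ) (μ : ℝ) :
    (tmKernel D μ).det.re = ∏ i, ((isHermitian_tmKernel D 0).eigenvalues i + μ ^ 2) := by
  rw [det_tmKernel_eq_prod, ← Complex.ofReal_prod, Complex.ofReal_re]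

/-- **The first reweighting factor** `W₁ = det(D†D)/det(D†D + μ²)` — (2.1) `det(D†D) = W det(D̃†D̃)` solved
for `W` with `D̃₁†D̃₁ = D†D + μ²` (`conjTranspose_twistedDirac_mul_self`).
[cite: LuscherPalombi2008, eqs. (2.1)–(2.2) and Table 1 (l = 1)] -/
noncomputable def rwFactor₁ (D : Matrix ι ι ℂ) (μ : ℝ) : ℝ :=
  (tmKernel D 0).det.re / (tmKernel D μ).det.re

/-- **The second reweighting factor** `W₂ = det(D†D) det(D†D + 2μ²)/det(D†D + μ²)²` — (2.1) with
`det(D̃₂†D̃₂) = det(D†D + μ²)²/det(D†D + 2μ²)` (Table 1, `l = 2`).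
[cite: LuscherPalombi2008, eqs. (2.1)–(2.2) and Table 1 (l = 2)] -/
noncomputable def rwFactor₂ (D : Matrix ι ι ℂ) (μ : ℝ) : ℝ :=
  (tmKernel D 0).det.re * (tmKernel D (Real.sqrt 2 * μ)).det.re / (tmKernel D μ).det.re ^ 2

/-- Unfolding lemma for `rwFactor₁`. [cite: LuscherPalombi2008, eq. (2.1)] -/
theorem rwFactor₁_def (D : Matrix ι ι ℂ) (μ : ℝ) :
    rwFactor₁ D μ = (tmKernel D 0).det.re / (tmKernel D μ).det.re := rfl

/-- Unfolding lemma for `rwFactor₂`. [cite: LuscherPalombi2008, eq. (2.1)] -/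
theorem rwFactor₂_def (D : Matrix ι ι ℂ) (μ : ℝ) :
    rwFactor₂ D μ =
      (tmKernel D 0).det.re * (tmKernel D (Real.sqrt 2 * μ)).det.re / (tmKernel D μ).det.re ^ 2 := rfl

/-- **(2.2) for `l = 1`: `W₁ = det{w₁(D†D)} = ∏ᵢ λᵢ/(λᵢ + μ²)`.**
[cite: LuscherPalombi2008, eq. (2.2) and Table 1 (l = 1)] -/
theorem rwFactor₁_eq_prod (D : Matrix ι ι ℂ) (μ : ℝ) :
    rwFactor₁ D μ = ∏ i, w₁ μ ((isHermitian_tmKernel D 0).eigenvalues i) := by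
  rw [rwFactor₁, det_tmKernel_re_eq_prod, det_tmKernel_re_eq_prod, ← Finset.prod_div_distrib]
  simp only [w₁, sq, mul_zero, add_zero]

/-- **(2.2) for `l = 2`: `W₂ = det{w₂(D†D)} = ∏ᵢ λᵢ(λᵢ + 2μ²)/(λᵢ + μ²)²`.**
[cite: LuscherPalombi2008, eq. (2.2) and Table 1 (l = 2)] -/
theorem rwFactor₂_eq_prod (D : Matrix ι ι ℂ) (μ : ℝ) :
    rwFactor₂ D μ = ∏ i, w₂ μ ((isHermitian_tmKernel D 0).eigenvalues i) := by
  rw [rwFactor₂, det_tmKernel_re_eq_prod, det_tmKernel_re_eq_prod, det_tmKernel_re_eq_prod,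
    ← Finset.prod_mul_distrib, ← Finset.prod_pow, ← Finset.prod_div_distrib]
  refine Finset.prod_congr rfl fun i _ => ?_
  rw [w₂, mul_pow, Real.sq_sqrt zero_le_two, sq (0 : ℝ), mul_zero, add_zero]

/-- **(2.2) as a determinant**: `det{w₁(D†D)} = W₁` (the functional calculus of `w₁` at `D†D`).
[cite: LuscherPalombi2008, eq. (2.2)] -/
theorem det_cfc_w₁ (D : Matrix ι ι ℂ) (μ : ℝ) :
    (cfc (w₁ μ) (tmKernel D 0)).det = (rwFactor₁ D μ : ℂ) := by
  rw [det_cfc (isHermitian_tmKernel D 0), rwFactor₁_eq_prod, Complex.ofReal_prod]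

/-- **(2.2) as a determinant**: `det{w₂(D†D)} = W₂`. [cite: LuscherPalombi2008, eq. (2.2)] -/
theorem det_cfc_w₂ (D : Matrix ι ι ℂ) (μ : ℝ) :
    (cfc (w₂ μ) (tmKernel D 0)).det = (rwFactor₂ D μ : ℂ) := by
  rw [det_cfc (isHermitian_tmKernel D 0), rwFactor₂_eq_prod, Complex.ofReal_prod]

/-- The eigenvalues of `D†D` are non-negative (private helper). [folklore] -/
private theorem eigenvalues_tmKernel_zero_nonneg (D : Matrix ι ι ℂ) (i : ι) :
    0 ≤ (isHermitian_tmKernel D 0).eigenvalues i :=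
  (posSemidef_tmKernel_zero D).eigenvalues_nonneg i

/-- The eigenvalues of `D†D` are positive when `D` is invertible (private helper). [folklore] -/
private theorem eigenvalues_tmKernel_zero_pos (hD : IsUnit D.det) (i : ι) :
    0 < (isHermitian_tmKernel D 0).eigenvalues i :=
  (posDef_tmKernel_zero hD).eigenvalues_pos i

/-- **`0 ≤ W₁ ≤ 1`** (lower half). [cite: LuscherPalombi2008, eqs. (2.1)–(2.2)] -/
theorem rwFactor₁_nonneg (D : Matrix ι ι ℂ) (μ : ℝ) : 0 ≤ rwFactor₁ D μ := by
  rw [rwFactor₁_eq_prod]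
  exact Finset.prod_nonneg fun i _ => w₁_nonneg μ (eigenvalues_tmKernel_zero_nonneg D i)

/-- **`0 ≤ W₁ ≤ 1`** (upper half): reweighting from the twisted-mass ensemble to `μ = 0` never
up-weights a gauge field. [cite: LuscherPalombi2008, eqs. (2.1)–(2.2)] -/
theorem rwFactor₁_le_one (D : Matrix ι ι ℂ) (μ : ℝ) : rwFactor₁ D μ ≤ 1 := by
  rw [rwFactor₁_eq_prod]
  exact Finset.prod_le_one (fun i _ => w₁_nonneg μ (eigenvalues_tmKernel_zero_nonneg D i))
    fun i _ => w₁_le_one μ (eigenvalues_tmKernel_zero_nonneg D i)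

/-- `W₁ > 0` for invertible `D` (every `μ`). [cite: LuscherPalombi2008, eqs. (2.1)–(2.2)] -/
theorem rwFactor₁_pos (hD : IsUnit D.det) (μ : ℝ) : 0 < rwFactor₁ D μ := by
  rw [rwFactor₁_eq_prod]
  exact Finset.prod_pos fun i _ => w₁_pos μ (eigenvalues_tmKernel_zero_pos hD i)

/-- `W₁ < 1` for `μ ≠ 0` (on a non-empty index set). [cite: LuscherPalombi2008, eqs. (2.1)–(2.2)] -/
theorem rwFactor₁_lt_one [Nonempty ι] (D : Matrix ι ι ℂ) {μ : ℝ} (hμ : μ ≠ 0) : rwFactor₁ D μ < 1 := by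
  rw [rwFactor₁_eq_prod]
  obtain ⟨i⟩ := ‹Nonempty ι›
  calc ∏ j, w₁ μ ((isHermitian_tmKernel D 0).eigenvalues j)
      ≤ ∏ j, (if j = i then w₁ μ ((isHermitian_tmKernel D 0).eigenvalues i) else 1) :=
        Finset.prod_le_prod (fun j _ => w₁_nonneg μ (eigenvalues_tmKernel_zero_nonneg D j)) fun j _ => by
          split_ifs with h
          · rw [h]
          · exact w₁_le_one μ (eigenvalues_tmKernel_zero_nonneg D j)
    _ = w₁ μ ((isHermitian_tmKernel D 0).eigenvalues i) := Finset.prod_ite_eq' Finset.univ i _ |>.trans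
        (if_pos (Finset.mem_univ i))
    _ < 1 := w₁_lt_one hμ (eigenvalues_tmKernel_zero_nonneg D i)

/-- **`0 ≤ W₂ ≤ 1`** (lower half). [cite: LuscherPalombi2008, eqs. (2.1)–(2.2)] -/
theorem rwFactor₂_nonneg (D : Matrix ι ι ℂ) (μ : ℝ) : 0 ≤ rwFactor₂ D μ := by
  rw [rwFactor₂_eq_prod]
  exact Finset.prod_nonneg fun i _ => w₂_nonneg μ (eigenvalues_tmKernel_zero_nonneg D i)

/-- **`0 ≤ W₂ ≤ 1`** (upper half). [cite: LuscherPalombi2008, eqs. (2.1)–(2.2)] -/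
theorem rwFactor₂_le_one (D : Matrix ι ι ℂ) (μ : ℝ) : rwFactor₂ D μ ≤ 1 := by
  rw [rwFactor₂_eq_prod]
  exact Finset.prod_le_one (fun i _ => w₂_nonneg μ (eigenvalues_tmKernel_zero_nonneg D i))
    fun i _ => w₂_le_one μ (eigenvalues_tmKernel_zero_nonneg D i)

/-- `W₂ > 0` for invertible `D`. [cite: LuscherPalombi2008, eqs. (2.1)–(2.2)] -/
theorem rwFactor₂_pos (hD : IsUnit D.det) (μ : ℝ) : 0 < rwFactor₂ D μ := by
  rw [rwFactor₂_eq_prod]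
  exact Finset.prod_pos fun i _ => w₂_pos μ (eigenvalues_tmKernel_zero_pos hD i)

/-- **`W₁ ≤ W₂`**: at equal `μ` the second factorisation reweights by less (its defect is of fourth
order in `μ/ν`, "a second suppression factor"). [cite: LuscherPalombi2008, Table 1 and §4] -/
theorem rwFactor₁_le_rwFactor₂ (D : Matrix ι ι ℂ) (μ : ℝ) : rwFactor₁ D μ ≤ rwFactor₂ D μ := by
  rw [rwFactor₁_eq_prod, rwFactor₂_eq_prod]
  exact Finset.prod_le_prod (fun i _ => w₁_nonneg μ (eigenvalues_tmKernel_zero_nonneg D i))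
    fun i _ => w₁_le_w₂ μ (eigenvalues_tmKernel_zero_nonneg D i)

/-- **(2.1), `l = 1`: `det(D†D) = W₁ · det(D̃₁†D̃₁)`** with `D̃₁ = D + iμγ₅` (for a `γ₅`-Hermitian `D`
and `μ ≠ 0`), as an identity of real numbers (both determinants are real).
[cite: LuscherPalombi2008, eq. (2.1) and Table 1 (l = 1)] -/
theorem det_eq_rwFactor₁_mul_det {γ : Matrix ι ι ℂ} (hγ : γᴴ = γ) (hγγ : γ * γ = 1)
    (hD : Dᴴ = γ * D * γ) {μ : ℝ} (hμ : μ ≠ 0) :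
    (Dᴴ * D).det.re = rwFactor₁ D μ * ((twistedDirac γ D μ)ᴴ * twistedDirac γ D μ).det.re := by
  rw [conjTranspose_twistedDirac_mul_self hγ hγγ hD, ← tmKernel_def, ← tmKernel_zero, rwFactor₁,
    div_mul_cancel₀ _ (det_tmKernel_pos D hμ).1.ne']

/-- **(2.1), `l = 2`: `det(D†D) = W₂ · [det(D†D + μ²)²/det(D†D + 2μ²)]`**, the bracket being
`det(D̃₂†D̃₂)` for the second modified operator of Table 1 (`μ ≠ 0`).
[cite: LuscherPalombi2008, eq. (2.1) and Table 1 (l = 2)] -/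
theorem det_eq_rwFactor₂_mul {μ : ℝ} (hμ : μ ≠ 0) :
    (tmKernel D 0).det.re =
      rwFactor₂ D μ * ((tmKernel D μ).det.re ^ 2 / (tmKernel D (Real.sqrt 2 * μ)).det.re) := by
  have h1 : (tmKernel D μ).det.re ≠ 0 := (det_tmKernel_pos D hμ).1.ne'
  have h2 : (tmKernel D (Real.sqrt 2 * μ)).det.re ≠ 0 :=
    (det_tmKernel_pos D (mul_ne_zero (Real.sqrt_ne_zero'.mpr two_pos) hμ)).1.ne'
  rw [rwFactor₂]; field_simp

end ReweightingFactors

/-! ## §3 Hasenbusch / twisted-mass preconditioning: the condition numbers of the two factors -/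

section ConditionNumbers

/-- Extremum of a monotone image of a finite set (private helper). [folklore] -/
private theorem sSup_image_of_monotoneOn {S : Set ℝ} (hS : S.Finite) (hne : S.Nonempty) {f : ℝ → ℝ}
    (hf : MonotoneOn f S) : sSup (f '' S) = f (sSup S) := by
  have hmem : sSup S ∈ S := hne.csSup_mem hS
  refine IsGreatest.csSup_eq ⟨⟨_, hmem, rfl⟩, ?_⟩
  rintro _ ⟨x, hx, rfl⟩
  exact hf hx hmem (le_csSup hS.bddAbove hx)

/-- Extremum of a monotone image of a finite set (private helper). [folklore] -/
private theorem sInf_image_of_monotoneOn {S : Set ℝ} (hS : S.Finite) (hne : S.Nonempty) {f : ℝ → ℝ}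
    (hf : MonotoneOn f S) : sInf (f '' S) = f (sInf S) := by
  have hmem : sInf S ∈ S := hne.csInf_mem hS
  refine IsLeast.csInf_eq ⟨⟨_, hmem, rfl⟩, ?_⟩
  rintro _ ⟨x, hx, rfl⟩
  exact hf hmem hx (csInf_le hS.bddBelow hx)

/-- Extremum of an antitone image of a finite set (private helper). [folklore] -/
private theorem sSup_image_of_antitoneOn {S : Set ℝ} (hS : S.Finite) (hne : S.Nonempty) {f : ℝ → ℝ}
    (hf : AntitoneOn f S) : sSup (f '' S) = f (sInf S) := by
  have hmem : sInf S ∈ S := hne.csInf_mem hS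
  refine IsGreatest.csSup_eq ⟨⟨_, hmem, rfl⟩, ?_⟩
  rintro _ ⟨x, hx, rfl⟩
  exact hf hmem hx (csInf_le hS.bddBelow hx)

/-- Extremum of an antitone image of a finite set (private helper). [folklore] -/
private theorem sInf_image_of_antitoneOn {S : Set ℝ} (hS : S.Finite) (hne : S.Nonempty) {f : ℝ → ℝ}
    (hf : AntitoneOn f S) : sInf (f '' S) = f (sSup S) := by
  have hmem : sSup S ∈ S := hne.csSup_mem hS
  refine IsLeast.csInf_eq ⟨⟨_, hmem, rfl⟩, ?_⟩
  rintro _ ⟨x, hx, rfl⟩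
  exact hf hx hmem (le_csSup hS.bddAbove hx)

variable {D : Matrix ι ι ℂ}

/-- The real spectrum of a positive-definite matrix is positive (private helper; Horn–Johnson Thm 7.2.1).
[folklore] -/
private theorem spectrum_pos_of_posDef {A : Matrix ι ι ℂ} (hA : A.PosDef) {x : ℝ}
    (hx : x ∈ spectrum ℝ A) : 0 < x := by
  rw [hA.1.spectrum_real_eq_range_eigenvalues] at hx
  obtain ⟨i, rfl⟩ := hx
  exact hA.eigenvalues_pos i

/-- The real spectrum of `D†D` is finite and nonempty (private helper). [folklore] -/
private theorem spectrum_tmKernel_zero_nonempty [Nonempty ι] (D : Matrix ι ι ℂ) :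
    (spectrum ℝ (tmKernel D 0)).Nonempty := by
  rw [(isHermitian_tmKernel D 0).spectrum_real_eq_range_eigenvalues]
  exact Set.range_nonempty _

/-- **`λ_max(D†D + μ²) = λ_max(D†D) + μ²`.** [cite: HasenbuschJansen2003, §2 ('the condition number of Q̂² + ρ²')] -/
theorem sSup_spectrum_tmKernel [Nonempty ι] (D : Matrix ι ι ℂ) (μ : ℝ) :
    sSup (spectrum ℝ (tmKernel D μ)) = sSup (spectrum ℝ (tmKernel D 0)) + μ ^ 2 := by
  rw [spectrum_tmKernel]
  exact sSup_image_of_monotoneOn (Matrix.finite_real_spectrum (A := tmKernel D 0))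
    (spectrum_tmKernel_zero_nonempty D) fun x _ y _ hxy => add_le_add hxy le_rfl

/-- **`λ_min(D†D + μ²) = λ_min(D†D) + μ²`.** [cite: HasenbuschJansen2003, §2 ('the condition number of Q̂² + ρ²')] -/
theorem sInf_spectrum_tmKernel [Nonempty ι] (D : Matrix ι ι ℂ) (μ : ℝ) :
    sInf (spectrum ℝ (tmKernel D μ)) = sInf (spectrum ℝ (tmKernel D 0)) + μ ^ 2 := by
  rw [spectrum_tmKernel]
  exact sInf_image_of_monotoneOn (Matrix.finite_real_spectrum (A := tmKernel D 0))
    (spectrum_tmKernel_zero_nonempty D) fun x _ y _ hxy => add_le_add hxy le_rfl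

/-- `λ_min(D†D) ≥ 0` (private helper). [folklore] -/
private theorem sInf_spectrum_tmKernel_zero_nonneg [Nonempty ι] (D : Matrix ι ι ℂ) :
    0 ≤ sInf (spectrum ℝ (tmKernel D 0)) :=
  spectrum_tmKernel_zero_nonneg D
    ((spectrum_tmKernel_zero_nonempty D).csInf_mem (Matrix.finite_real_spectrum (A := tmKernel D 0)))

/-- `λ_min(D†D) > 0` for invertible `D` (private helper). [folklore] -/
private theorem sInf_spectrum_tmKernel_zero_pos [Nonempty ι] (hD : IsUnit D.det) :
    0 < sInf (spectrum ℝ (tmKernel D 0)) := by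
  have hmem := (spectrum_tmKernel_zero_nonempty D).csInf_mem
    (Matrix.finite_real_spectrum (A := tmKernel D 0))
  rw [(isHermitian_tmKernel D 0).spectrum_real_eq_range_eigenvalues] at hmem
  obtain ⟨i, hi⟩ := hmem
  rw [← (isHermitian_tmKernel D 0).spectrum_real_eq_range_eigenvalues] at hi
  rw [← hi]
  exact (posDef_tmKernel_zero hD).eigenvalues_pos i

/-- `λ_min(D†D) ≤ λ_max(D†D)` (private helper). [folklore] -/
private theorem sInf_le_sSup_spectrum_tmKernel_zero [Nonempty ι] (D : Matrix ι ι ℂ) :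
    sInf (spectrum ℝ (tmKernel D 0)) ≤ sSup (spectrum ℝ (tmKernel D 0)) :=
  csInf_le_csSup (spectrum_tmKernel_zero_nonempty D)
    (Matrix.finite_real_spectrum (A := tmKernel D 0)).bddBelow
    (Matrix.finite_real_spectrum (A := tmKernel D 0)).bddAbove

/-- **The condition number of the first Hasenbusch factor** `W⁺W⁻ = Q² + μ²` (the matrix `Q̂² + ρ²` of
Hasenbusch–Jansen's `S̃_F1`; its inverse, the actual pseudofermion kernel, has the same condition number,
`condNumber_inv`): `κ(D†D + μ²) = (λ_max + μ²)/(λ_min + μ²)` EXACTLY.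
[cite: HasenbuschJansen2003, §2 ('we find the condition number of Q̂² + ρ² to be λ_max/ρ²')]
[cite: UrbachEtAl2006, §3 ('the condition number of Q² + μ² is approximately λ_max/μ²')] -/
theorem condNumber_tmKernel [Nonempty ι] (D : Matrix ι ι ℂ) (μ : ℝ) :
    condNumber (tmKernel D μ) =
      (sSup (spectrum ℝ (tmKernel D 0)) + μ ^ 2) / (sInf (spectrum ℝ (tmKernel D 0)) + μ ^ 2) := by
  rw [condNumber_def, sSup_spectrum_tmKernel, sInf_spectrum_tmKernel]

/-- **Hasenbusch–Jansen's approximation `λ_max/ρ²` is an upper bound up to one**: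
`κ(D†D + μ²) ≤ 1 + λ_max/μ²` for `μ ≠ 0`, whatever `λ_min ≥ 0` is (this is where the twisted mass removes
the dependence on the smallest eigenvalue). [cite: HasenbuschJansen2003, §2 ('λ_max/ρ²')] -/
theorem condNumber_tmKernel_le [Nonempty ι] (D : Matrix ι ι ℂ) {μ : ℝ} (hμ : μ ≠ 0) :
    condNumber (tmKernel D μ) ≤ 1 + sSup (spectrum ℝ (tmKernel D 0)) / μ ^ 2 := by
  have hμ2 : 0 < μ ^ 2 := by positivity
  have h0 := sInf_spectrum_tmKernel_zero_nonneg D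
  rw [condNumber_tmKernel, div_le_iff₀ (by positivity)]
  have h1 : 0 ≤ sSup (spectrum ℝ (tmKernel D 0)) := h0.trans (sInf_le_sSup_spectrum_tmKernel_zero D)
  have h2 : 0 ≤ sSup (spectrum ℝ (tmKernel D 0)) / μ ^ 2 * sInf (spectrum ℝ (tmKernel D 0)) := by
    positivity
  calc sSup (spectrum ℝ (tmKernel D 0)) + μ ^ 2
      = (1 + sSup (spectrum ℝ (tmKernel D 0)) / μ ^ 2) * μ ^ 2 := by field_simp; ring
    _ ≤ (1 + sSup (spectrum ℝ (tmKernel D 0)) / μ ^ 2) * (sInf (spectrum ℝ (tmKernel D 0)) + μ ^ 2) := by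
        nlinarith

/-- **The twisted mass never worsens the conditioning**: `κ(D†D + μ²) ≤ κ(D†D)` (invertible `D`).
[cite: HasenbuschJansen2003, §2 ('matrices with reduced condition number')] -/
theorem condNumber_tmKernel_le_condNumber [Nonempty ι] (hD : IsUnit D.det) (μ : ℝ) :
    condNumber (tmKernel D μ) ≤ condNumber (tmKernel D 0) := by
  have hmin := sInf_spectrum_tmKernel_zero_pos hD
  have hle := sInf_le_sSup_spectrum_tmKernel_zero D
  rw [condNumber_tmKernel, condNumber_def, div_le_div_iff₀ (by positivity) hmin]
  nlinarith [sq_nonneg μ]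

/-- **Hasenbusch–Jansen's second matrix `1 + ρ²Q̂⁻²`** (the kernel of `S̃_F2 = φ₂†[1 + ρ²Q̂⁻²]φ₂`; Urbach
et al.'s `Q²/(Q² + μ²)` is its inverse, with the same condition number): `R_μ = 1 + μ²(D†D)⁻¹`.
[cite: HasenbuschJansen2003, §2 (S̃_F2 = φ₂†[1 + ρ²Q̂⁻²]φ₂)] -/
noncomputable def ratioKernel (D : Matrix ι ι ℂ) (μ : ℝ) : Matrix ι ι ℂ :=
  1 + ((μ ^ 2 : ℝ) : ℂ) • (tmKernel D 0)⁻¹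

/-- Unfolding lemma for `ratioKernel`. [cite: HasenbuschJansen2003, §2] -/
theorem ratioKernel_def (D : Matrix ι ι ℂ) (μ : ℝ) :
    ratioKernel D μ = 1 + ((μ ^ 2 : ℝ) : ℂ) • (tmKernel D 0)⁻¹ := rfl

/-- **`R_μ · D†D = D†D + μ²`**: the two Hasenbusch factors multiply back to the twisted-mass kernel, i.e.
`det(Q²) = det(W⁺W⁻) · det(Q²)/det(W⁺W⁻)` as matrices (invertible `D`).
[cite: UrbachEtAl2006, §3 (first display)] [cite: Hasenbusch2001, §2 (det M†M ∝ ∫∫ e^{−|M̃⁻¹ψ|²} e^{−|M̃M⁻¹φ|²})] -/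
theorem ratioKernel_mul_tmKernel_zero (hD : IsUnit D.det) (μ : ℝ) :
    ratioKernel D μ * tmKernel D 0 = tmKernel D μ := by
  have hA : IsUnit (tmKernel D 0).det := by
    rw [tmKernel_zero, det_mul, det_conjTranspose]; exact (hD.star).mul hD
  rw [ratioKernel, Matrix.add_mul, Matrix.one_mul, Matrix.smul_mul, Matrix.nonsing_inv_mul _ hA,
    tmKernel_def D μ, tmKernel_zero]

/-- `det R_μ = det(D†D + μ²)/det(D†D) = 1/W₁` (invertible `D`).
[cite: LuscherPalombi2008, eqs. (2.1)–(2.2)] -/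
theorem det_ratioKernel_re (hD : IsUnit D.det) (μ : ℝ) :
    (ratioKernel D μ).det.re = (rwFactor₁ D μ)⁻¹ := by
  have h := congrArg Matrix.det (ratioKernel_mul_tmKernel_zero hD μ)
  rw [det_mul] at h
  have h0 : (tmKernel D 0).det.re ≠ 0 := by
    rw [det_tmKernel_zero_re]; exact pow_ne_zero 2 (norm_ne_zero_iff.mpr hD.ne_zero)
  have hre : (ratioKernel D μ).det.re * (tmKernel D 0).det.re = (tmKernel D μ).det.re := by
    have him0 : (tmKernel D 0).det.im = 0 := (det_tmKernel_nonneg D 0).2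
    have h' := congrArg Complex.re h
    rw [Complex.mul_re, him0, mul_zero, sub_zero] at h'
    exact h'
  rw [rwFactor₁, inv_div, eq_div_iff h0, hre]

/-- `x ↦ x⁻¹` at `D†D` is the matrix inverse (invertible `D`; private helper). [folklore] -/
private theorem cfc_inv_tmKernel_zero (hD : IsUnit D.det) :
    cfc (fun x : ℝ => x⁻¹) (tmKernel D 0) = (tmKernel D 0)⁻¹ := by
  have h := cfc_inv_add_const (isHermitian_tmKernel D 0) (b := 0) fun x hx => by
    rw [add_zero]; exact (spectrum_pos_of_posDef (posDef_tmKernel_zero hD) hx).ne'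
  simp only [add_zero, Complex.ofReal_zero, zero_smul] at h
  exact h

/-- `R_μ` is the functional calculus of `x ↦ 1 + μ²/x` at `D†D` (invertible `D`; private helper).
[folklore] -/
private theorem ratioKernel_eq_cfc (hD : IsUnit D.det) (μ : ℝ) :
    ratioKernel D μ = cfc (fun x : ℝ => 1 + μ ^ 2 * x⁻¹) (tmKernel D 0) := by
  have h0 := (isHermitian_tmKernel D 0).isSelfAdjoint
  have hcont := fun f : ℝ → ℝ => (Matrix.finite_real_spectrum (A := tmKernel D 0)).continuousOn f
  rw [cfc_const_add (1 : ℝ) (fun x : ℝ => μ ^ 2 * x⁻¹) (tmKernel D 0) (hcont _) h0,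
    cfc_const_mul (μ ^ 2) (fun x : ℝ => x⁻¹) (tmKernel D 0) (hcont _), cfc_inv_tmKernel_zero hD,
    map_one, ratioKernel, RCLike.real_smul_eq_coe_smul (K := ℂ)]
  rfl

/-- The spectrum of `R_μ` is `{1 + μ²/λ : λ ∈ spec(D†D)}` (invertible `D`).
[cite: HasenbuschJansen2003, §2 ('the condition number of the second matrix … becomes ρ²/λ_min')] -/
theorem spectrum_ratioKernel (hD : IsUnit D.det) (μ : ℝ) :
    spectrum ℝ (ratioKernel D μ) = (fun x : ℝ => 1 + μ ^ 2 * x⁻¹) '' spectrum ℝ (tmKernel D 0) := by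
  rw [ratioKernel_eq_cfc hD μ]
  exact cfc_map_spectrum _ (tmKernel D 0) (isHermitian_tmKernel D 0).isSelfAdjoint
    ((Matrix.finite_real_spectrum (A := tmKernel D 0)).continuousOn _)

/-- `R_μ` is Hermitian positive definite (invertible `D`): a legitimate pseudofermion kernel.
[cite: HasenbuschJansen2003, §2 (S̃_F2)] -/
theorem posDef_ratioKernel (hD : IsUnit D.det) (μ : ℝ) : (ratioKernel D μ).PosDef := by
  rw [ratioKernel_eq_cfc hD μ]
  exact posDef_cfc_of_pos (isHermitian_tmKernel D 0) fun x hx =>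
    add_pos_of_pos_of_nonneg one_pos
      (mul_nonneg (sq_nonneg μ) (inv_nonneg.mpr (spectrum_pos_of_posDef (posDef_tmKernel_zero hD) hx).le))

/-- `x ↦ 1 + μ²/x` is antitone on the (positive) spectrum of `D†D` (private helper). [folklore] -/
private theorem antitoneOn_ratio (hD : IsUnit D.det) (μ : ℝ) :
    AntitoneOn (fun x : ℝ => 1 + μ ^ 2 * x⁻¹) (spectrum ℝ (tmKernel D 0)) := fun _ hx _ _ hxy =>
  add_le_add le_rfl (mul_le_mul_of_nonneg_left
    (inv_anti₀ (spectrum_pos_of_posDef (posDef_tmKernel_zero hD) hx) hxy) (sq_nonneg μ))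

/-- **The condition number of the second Hasenbusch factor**: `κ(1 + μ²(D†D)⁻¹) =
(1 + μ²/λ_min)/(1 + μ²/λ_max)` EXACTLY (invertible `D`).
[cite: HasenbuschJansen2003, §2 ('the condition number of the second matrix … becomes ρ²/λ_min')]
[cite: UrbachEtAl2006, §3 ('the one of Q²/(Q² + μ²) approximately μ²/λ_min')] -/
theorem condNumber_ratioKernel [Nonempty ι] (hD : IsUnit D.det) (μ : ℝ) :
    condNumber (ratioKernel D μ) =
      (1 + μ ^ 2 * (sInf (spectrum ℝ (tmKernel D 0)))⁻¹) /
        (1 + μ ^ 2 * (sSup (spectrum ℝ (tmKernel D 0)))⁻¹) := by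
  have hfin := Matrix.finite_real_spectrum (A := tmKernel D 0)
  rw [condNumber_def, spectrum_ratioKernel hD, sSup_image_of_antitoneOn hfin
    (spectrum_tmKernel_zero_nonempty D) (antitoneOn_ratio hD μ), sInf_image_of_antitoneOn hfin
    (spectrum_tmKernel_zero_nonempty D) (antitoneOn_ratio hD μ)]

/-- **Hasenbusch–Jansen's `ρ²/λ_min` is an upper bound up to one**: `κ(R_μ) ≤ 1 + μ²/λ_min`.
[cite: HasenbuschJansen2003, §2 ('ρ²/λ_min')] -/
theorem condNumber_ratioKernel_le [Nonempty ι] (hD : IsUnit D.det) (μ : ℝ) :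
    condNumber (ratioKernel D μ) ≤ 1 + μ ^ 2 * (sInf (spectrum ℝ (tmKernel D 0)))⁻¹ := by
  have hmin := sInf_spectrum_tmKernel_zero_pos hD
  have hmax : 0 < sSup (spectrum ℝ (tmKernel D 0)) := hmin.trans_le (sInf_le_sSup_spectrum_tmKernel_zero D)
  rw [condNumber_ratioKernel hD]
  refine div_le_self (by positivity) ?_
  exact le_add_of_nonneg_right (by positivity)

/-- **The EXACT content of the two approximate statements** ("condition number of `Q̂² + ρ²` …
`λ_max/ρ²`", "… of the second matrix … `ρ²/λ_min`", whose product is `λ_max/λ_min`): for every `μ`,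
`κ(D†D + μ²) · κ(1 + μ²(D†D)⁻¹) = κ(D†D)` — mass preconditioning redistributes the condition number
between the two factors multiplicatively and exactly (invertible `D`).
[cite: HasenbuschJansen2003, §2 (rule ρ² = √(λ_max λ_min) and 'k … reduced to √k')]
[cite: UrbachEtAl2006, §3 ('these two condition numbers are equal to √(λ_max/λ_min)')] -/
theorem condNumber_tmKernel_mul_condNumber_ratioKernel [Nonempty ι] (hD : IsUnit D.det) (μ : ℝ) :
    condNumber (tmKernel D μ) * condNumber (ratioKernel D μ) = condNumber (tmKernel D 0) := by
  have hmin := sInf_spectrum_tmKernel_zero_pos hD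
  have hmax : 0 < sSup (spectrum ℝ (tmKernel D 0)) := hmin.trans_le (sInf_le_sSup_spectrum_tmKernel_zero D)
  rw [condNumber_tmKernel, condNumber_ratioKernel hD, condNumber_def]
  field_simp

/-- **Hasenbusch–Jansen's rule `ρ² = √(λ_max λ_min)` makes the first factor's condition number EXACTLY
`√κ(D†D)`** ("the condition number `k` of the original action … is reduced to `√k`").
[cite: HasenbuschJansen2003, §2 (ρ² = √(λ_max λ_min); 'k … reduced to √k')]
[cite: UrbachEtAl2006, §3 ('With μ² = √(λ_max λ_min) these two condition numbers are equal to √(λ_max/λ_min)')] -/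
theorem condNumber_tmKernel_eq_sqrt [Nonempty ι] (hD : IsUnit D.det) {μ : ℝ}
    (hμ : μ ^ 2 = Real.sqrt (sSup (spectrum ℝ (tmKernel D 0)) * sInf (spectrum ℝ (tmKernel D 0)))) :
    condNumber (tmKernel D μ) = Real.sqrt (condNumber (tmKernel D 0)) := by
  have hmin := sInf_spectrum_tmKernel_zero_pos hD
  have hmax : 0 < sSup (spectrum ℝ (tmKernel D 0)) := hmin.trans_le (sInf_le_sSup_spectrum_tmKernel_zero D)
  set a := Real.sqrt (sSup (spectrum ℝ (tmKernel D 0))) with ha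
  set b := Real.sqrt (sInf (spectrum ℝ (tmKernel D 0))) with hb
  have ha0 : 0 < a := Real.sqrt_pos.mpr hmax
  have hb0 : 0 < b := Real.sqrt_pos.mpr hmin
  have ha2 : sSup (spectrum ℝ (tmKernel D 0)) = a ^ 2 := (Real.sq_sqrt hmax.le).symm
  have hb2 : sInf (spectrum ℝ (tmKernel D 0)) = b ^ 2 := (Real.sq_sqrt hmin.le).symm
  rw [condNumber_tmKernel, condNumber_def, hμ, ha2, hb2, Real.sqrt_mul (sq_nonneg a), Real.sqrt_sq ha0.le,
    Real.sqrt_sq hb0.le, Real.sqrt_div (sq_nonneg a), Real.sqrt_sq ha0.le, Real.sqrt_sq hb0.le]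
  field_simp
  ring

/-- **… and the second factor's, too**: at `μ² = √(λ_max λ_min)`, `κ(1 + μ²(D†D)⁻¹) = √κ(D†D)`.
[cite: HasenbuschJansen2003, §2 (ρ² = √(λ_max λ_min))]
[cite: UrbachEtAl2006, §3 ('these two condition numbers are equal to √(λ_max/λ_min)')] -/
theorem condNumber_ratioKernel_eq_sqrt [Nonempty ι] (hD : IsUnit D.det) {μ : ℝ}
    (hμ : μ ^ 2 = Real.sqrt (sSup (spectrum ℝ (tmKernel D 0)) * sInf (spectrum ℝ (tmKernel D 0)))) :
    condNumber (ratioKernel D μ) = Real.sqrt (condNumber (tmKernel D 0)) := by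
  have hprod := condNumber_tmKernel_mul_condNumber_ratioKernel hD μ
  have h1 := condNumber_tmKernel_eq_sqrt hD hμ
  have hκ : 0 < condNumber (tmKernel D 0) :=
    lt_of_lt_of_le one_pos (one_le_condNumber (posDef_tmKernel_zero hD))
  have hs : 0 < Real.sqrt (condNumber (tmKernel D 0)) := Real.sqrt_pos.mpr hκ
  rw [h1] at hprod
  have h2 : Real.sqrt (condNumber (tmKernel D 0)) * Real.sqrt (condNumber (tmKernel D 0)) =
      condNumber (tmKernel D 0) := Real.mul_self_sqrt hκ.le
  nlinarith [hprod, h2, hs]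

/-- The spectrum of the inverse of a positive-definite matrix (private helper). [folklore] -/
private theorem spectrum_inv_of_posDef {A : Matrix ι ι ℂ} (hA : A.PosDef) :
    spectrum ℝ A⁻¹ = (fun x : ℝ => x⁻¹) '' spectrum ℝ A := by
  have h := cfc_inv_add_const hA.1 (b := 0) fun x hx => by
    rw [add_zero]; exact (spectrum_pos_of_posDef hA hx).ne'
  simp only [add_zero, Complex.ofReal_zero, zero_smul] at h
  rw [← h]
  exact cfc_map_spectrum _ A hA.1.isSelfAdjoint ((Matrix.finite_real_spectrum (A := A)).continuousOn _)

/-- **A pseudofermion kernel and its inverse have the same condition number**: `κ(ℳ⁻¹) = κ(ℳ)` for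
positive-definite `ℳ` — so `κ` of Hasenbusch–Jansen's kernel `[Q̂² + ρ²]⁻¹` is `condNumber_tmKernel`, and
`κ` of Urbach et al.'s `Q²/(Q² + μ²)` is `condNumber_ratioKernel`.
[cite: HasenbuschJansen2003, §2 (S̃_F1 = φ₁†[Q̂² + ρ²]⁻¹φ₁)] -/
theorem condNumber_inv [Nonempty ι] {A : Matrix ι ι ℂ} (hA : A.PosDef) : condNumber A⁻¹ = condNumber A := by
  have hfin := Matrix.finite_real_spectrum (A := A)
  have hne : (spectrum ℝ A).Nonempty := by
    rw [hA.1.spectrum_real_eq_range_eigenvalues]; exact Set.range_nonempty _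
  have hanti : AntitoneOn (fun x : ℝ => x⁻¹) (spectrum ℝ A) := fun x hx y _ hxy =>
    inv_anti₀ (spectrum_pos_of_posDef hA hx) hxy
  have hmin : 0 < sInf (spectrum ℝ A) := spectrum_pos_of_posDef hA (hne.csInf_mem hfin)
  have hmax : 0 < sSup (spectrum ℝ A) := spectrum_pos_of_posDef hA (hne.csSup_mem hfin)
  rw [condNumber_def, condNumber_def, spectrum_inv_of_posDef hA, sSup_image_of_antitoneOn hfin hne hanti,
    sInf_image_of_antitoneOn hfin hne hanti, inv_div_inv]

end ConditionNumbers

/-! ## §4 The pseudofermion estimator of the reweighting factor (Lüscher–Palombi (6.1)–(6.2)) -/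

section Estimator

variable {A : Matrix ι ι ℂ}

/-- **Lüscher–Palombi (6.2), one pseudofermion sample, any admissible `w`.** For a Hermitian `ℳ` and a
function `w` positive on its spectrum, the Gaussian average over `η ∼ e^{−(η,η)}` (the action (6.1)) of
the estimator `exp{(η, [1 − w(ℳ)⁻¹] η)}` is `det w(ℳ) = ∏ᵢ w(λᵢ)`:
`∫_{ℂ^N} e^{−(η,η)} exp{(η, [1 − w(ℳ)⁻¹] η)} dη = π^N ∏ᵢ w(λᵢ)` — "This procedure is correct for any
`N ≥ 1`" (the `N`-sample mean (6.2) is then unbiased for `W = det w(D†D)` by linearity).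
[cite: LuscherPalombi2008, eqs. (6.1)–(6.2)] -/
theorem integral_rwEstimator (hA : A.IsHermitian) {w : ℝ → ℝ} (hw : ∀ x ∈ spectrum ℝ A, 0 < w x) :
    ∫ η : ι → ℂ, Real.exp (-(star η ⬝ᵥ η).re) *
        Real.exp ((star η ⬝ᵥ (1 - cfc (fun t : ℝ => (w t)⁻¹) A) *ᵥ η).re) =
      Real.pi ^ Fintype.card ι * ∏ i, w (hA.eigenvalues i) := by
  have hpt : ∀ η : ι → ℂ, Real.exp (-(star η ⬝ᵥ η).re) *
      Real.exp ((star η ⬝ᵥ (1 - cfc (fun t : ℝ => (w t)⁻¹) A) *ᵥ η).re) =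
      Real.exp (-(star η ⬝ᵥ (cfc (fun t : ℝ => (w t)⁻¹) A) *ᵥ η).re) := by
    intro η
    rw [← Real.exp_add, Matrix.sub_mulVec, one_mulVec, dotProduct_sub, Complex.sub_re]
    ring_nf
  simp_rw [hpt]
  rw [integral_exp_neg_quadForm_cfc hA (fun x hx => inv_pos.mpr (hw x hx)), Finset.prod_inv_distrib,
    div_inv_eq_mul]

/-- **Each sample of (6.2) lies in `(0, 1]`** when `0 < w ≤ 1` on the spectrum (as for `w₁`, `w₂`): the
exponent `(η, [1 − w(ℳ)⁻¹] η)` is `≤ 0`, so the estimator is bounded — its moments of every order are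
finite for every gauge field. [cite: LuscherPalombi2008, eq. (6.2) with Table 1 (0 < w_l ≤ 1)] -/
theorem rwEstimator_le_one (hA : A.IsHermitian) {w : ℝ → ℝ}
    (hw : ∀ x ∈ spectrum ℝ A, 0 < w x ∧ w x ≤ 1) (η : ι → ℂ) :
    Real.exp ((star η ⬝ᵥ (1 - cfc (fun t : ℝ => (w t)⁻¹) A) *ᵥ η).re) ≤ 1 := by
  rw [Real.exp_le_one_iff, Matrix.sub_mulVec, one_mulVec, dotProduct_sub, Complex.sub_re, sub_nonpos]
  have h1 : (star η ⬝ᵥ η).re = (star η ⬝ᵥ (cfc (fun _ : ℝ => (1 : ℝ)) A) *ᵥ η).re := by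
    rw [cfc_const_one ℝ A hA.isSelfAdjoint, one_mulVec]
  rw [h1, re_quadForm_cfc hA, re_quadForm_cfc hA]
  refine Finset.sum_le_sum fun i _ => mul_le_mul_of_nonneg_right ?_ (sq_nonneg _)
  have h := hw _ (hA.eigenvalues_mem_spectrum_real i)
  exact one_le_inv_iff₀.mpr h

/-- Each sample of (6.2) is positive. [cite: LuscherPalombi2008, eq. (6.2)] -/
theorem rwEstimator_pos (A : Matrix ι ι ℂ) (w : ℝ → ℝ) (η : ι → ℂ) :
    0 < Real.exp ((star η ⬝ᵥ (1 - cfc (fun t : ℝ => (w t)⁻¹) A) *ᵥ η).re) :=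
  Real.exp_pos _

variable {D : Matrix ι ι ℂ}

/-- **For `l = 1` the exponent of (6.2) is `−μ²(η, (D†D)⁻¹η)`**: `1 − w₁(D†D)⁻¹ = −μ²(D†D)⁻¹`
(invertible `D`; `w₁(t)⁻¹ = 1 + μ²/t`). [cite: LuscherPalombi2008, eq. (6.2) with Table 1 (l = 1)] -/
theorem one_sub_cfc_w₁_inv (hD : IsUnit D.det) (μ : ℝ) :
    1 - cfc (fun t : ℝ => (w₁ μ t)⁻¹) (tmKernel D 0) = -(((μ ^ 2 : ℝ) : ℂ) • (tmKernel D 0)⁻¹) := by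
  have heq : (spectrum ℝ (tmKernel D 0)).EqOn (fun t : ℝ => (w₁ μ t)⁻¹) (fun t : ℝ => 1 + μ ^ 2 * t⁻¹) := by
    intro t ht
    have ht0 : t ≠ 0 := (spectrum_pos_of_posDef (posDef_tmKernel_zero hD) ht).ne'
    simp only [w₁, inv_div]
    field_simp
  rw [cfc_congr heq, ← ratioKernel_eq_cfc hD μ, ratioKernel, sub_add_cancel_left]

/-- **Lüscher–Palombi (6.2) for `l = 1`:** `∫ e^{−(η,η)} e^{−μ²(η,(D†D)⁻¹η)} dη = π^N W₁` — one Gaussian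
pseudofermion and one solve give an unbiased estimate of the twisted-mass reweighting factor
(invertible `D`). [cite: LuscherPalombi2008, eqs. (6.1)–(6.2) and Table 1 (l = 1)] -/
theorem integral_rwEstimator₁ (hD : IsUnit D.det) (μ : ℝ) :
    ∫ η : ι → ℂ, Real.exp (-(star η ⬝ᵥ η).re) *
        Real.exp (-(μ ^ 2 * (star η ⬝ᵥ (Dᴴ * D)⁻¹ *ᵥ η).re)) =
      Real.pi ^ Fintype.card ι * rwFactor₁ D μ := by
  have h := integral_rwEstimator (isHermitian_tmKernel D 0) (w := w₁ μ)
    (fun x hx => w₁_pos μ (spectrum_pos_of_posDef (posDef_tmKernel_zero hD) hx))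
  rw [one_sub_cfc_w₁_inv hD μ, ← rwFactor₁_eq_prod] at h
  have hpt : ∀ η : ι → ℂ, (star η ⬝ᵥ (-(((μ ^ 2 : ℝ) : ℂ) • (tmKernel D 0)⁻¹)) *ᵥ η).re =
      -(μ ^ 2 * (star η ⬝ᵥ (Dᴴ * D)⁻¹ *ᵥ η).re) := by
    intro η
    rw [Matrix.neg_mulVec, dotProduct_neg, Complex.neg_re, Matrix.smul_mulVec, dotProduct_smul, smul_eq_mul,
      Complex.re_ofReal_mul, tmKernel_zero]
  simp_rw [hpt] at h
  exact h

/-- The second moment of the `l = 1` sample: `∫ e^{−(η,η)} [e^{−μ²(η,(D†D)⁻¹η)}]² dη = π^N W₁(√2 μ)`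
(the same integral at twisted mass `√2 μ`). [cite: LuscherPalombi2008, eqs. (6.1)–(6.2) and Table 1 (l = 1)] -/
theorem integral_rwEstimator₁_sq (hD : IsUnit D.det) (μ : ℝ) :
    ∫ η : ι → ℂ, Real.exp (-(star η ⬝ᵥ η).re) *
        Real.exp (-(μ ^ 2 * (star η ⬝ᵥ (Dᴴ * D)⁻¹ *ᵥ η).re)) ^ 2 =
      Real.pi ^ Fintype.card ι * rwFactor₁ D (Real.sqrt 2 * μ) := by
  have h := integral_rwEstimator₁ hD (Real.sqrt 2 * μ)
  have hpt : ∀ η : ι → ℂ, Real.exp (-(μ ^ 2 * (star η ⬝ᵥ (Dᴴ * D)⁻¹ *ᵥ η).re)) ^ 2 =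
      Real.exp (-((Real.sqrt 2 * μ) ^ 2 * (star η ⬝ᵥ (Dᴴ * D)⁻¹ *ᵥ η).re)) := by
    intro η
    rw [← Real.exp_nat_mul, mul_pow, Real.sq_sqrt zero_le_two]
    push_cast
    ring_nf
  simp_rw [hpt]
  exact h

/-- `W₁(μ)² = W₂(μ) · W₁(√2 μ)` (`μ ≠ 0`): the algebra relating the two reweighting factors and the second
moment of the `l = 1` estimator. [cite: LuscherPalombi2008, Table 1] -/
theorem rwFactor₁_sq (D : Matrix ι ι ℂ) {μ : ℝ} (hμ : μ ≠ 0) :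
    rwFactor₁ D μ ^ 2 = rwFactor₂ D μ * rwFactor₁ D (Real.sqrt 2 * μ) := by
  have h1 : (tmKernel D μ).det.re ≠ 0 := (det_tmKernel_pos D hμ).1.ne'
  have h2 : (tmKernel D (Real.sqrt 2 * μ)).det.re ≠ 0 :=
    (det_tmKernel_pos D (mul_ne_zero (Real.sqrt_ne_zero'.mpr two_pos) hμ)).1.ne'
  rw [rwFactor₁, rwFactor₁, rwFactor₂]
  field_simp

/-- COROLLARY (elementary; from (6.2) and Table 1): the VARIANCE of one `l = 1` sample,
`π^{−N}∫ f² − (π^{−N}∫ f)² = W₁(√2μ) − W₁(μ)²`, equals `W₁(√2 μ)(1 − W₂(μ))`; equivalently the relative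
variance of the one-sample estimator of `W₁` is exactly `1/W₂ − 1` (`μ ≠ 0`).
[cite: LuscherPalombi2008, eqs. (6.1)–(6.2) and Table 1] -/
theorem variance_rwEstimator₁ (D : Matrix ι ι ℂ) {μ : ℝ} (hμ : μ ≠ 0) :
    rwFactor₁ D (Real.sqrt 2 * μ) - rwFactor₁ D μ ^ 2 =
      rwFactor₁ D (Real.sqrt 2 * μ) * (1 - rwFactor₂ D μ) := by
  rw [rwFactor₁_sq D hμ]; ring

end Estimator

/-! ## §5 Lüscher–Palombi (3.2): `W_l = e^{−X_l}`, `X_l = ∫₀^{μ²} ds₁…ds_l Tr (D†D + s₁ + … + s_l)^{−l}` -/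

section IntegralRepresentation

variable {A D : Matrix ι ι ℂ}

/-- Trace of a function of a Hermitian matrix: `Tr f(ℳ) = Σᵢ f(λᵢ)` (private helper; Golub–Van Loan
(9.1.9) under the trace). [folklore] -/
private theorem trace_cfc (hA : A.IsHermitian) (f : ℝ → ℝ) :
    (cfc f A).trace = ∑ i, ((f (hA.eigenvalues i) : ℝ) : ℂ) := by
  rw [cfc_eq_conj_diagonal hA f, Matrix.trace_mul_cycle,
    Unitary.star_mul_self_of_mem hA.eigenvectorUnitary.property, Matrix.one_mul, Matrix.trace_diagonal]

/-- **`Tr (D†D + s)⁻¹ = Σᵢ (λᵢ + s)⁻¹`** (no `−s` in the spectrum), the integrand of (3.2) for `l = 1`.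
[cite: LuscherPalombi2008, eq. (3.2) (l = 1)] -/
theorem trace_inv_tmKernel_zero_add_re (D : Matrix ι ι ℂ) {s : ℝ}
    (hs : ∀ x ∈ spectrum ℝ (tmKernel D 0), x + s ≠ 0) :
    ((tmKernel D 0 + (s : ℂ) • (1 : Matrix ι ι ℂ))⁻¹).trace.re =
      ∑ i, ((isHermitian_tmKernel D 0).eigenvalues i + s)⁻¹ := by
  rw [← cfc_inv_add_const (isHermitian_tmKernel D 0) hs, trace_cfc, ← Complex.ofReal_sum, Complex.ofReal_re]

/-- **`Tr (D†D + s)⁻² = Σᵢ (λᵢ + s)⁻²`**, the integrand of (3.2) for `l = 2`.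
[cite: LuscherPalombi2008, eq. (3.2) (l = 2)] -/
theorem trace_inv_tmKernel_zero_add_sq_re (D : Matrix ι ι ℂ) {s : ℝ}
    (hs : ∀ x ∈ spectrum ℝ (tmKernel D 0), x + s ≠ 0) :
    (((tmKernel D 0 + (s : ℂ) • (1 : Matrix ι ι ℂ))⁻¹) ^ 2).trace.re =
      ∑ i, ((isHermitian_tmKernel D 0).eigenvalues i + s)⁻¹ ^ 2 := by
  have h0 := (isHermitian_tmKernel D 0).isSelfAdjoint
  rw [← cfc_inv_add_const (isHermitian_tmKernel D 0) hs,
    ← cfc_pow (fun x : ℝ => (x + s)⁻¹) 2 (tmKernel D 0)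
      ((Matrix.finite_real_spectrum (A := tmKernel D 0)).continuousOn _) h0,
    trace_cfc, ← Complex.ofReal_sum, Complex.ofReal_re]

/-- **`X₁ = ∫₀^{μ²} ds Tr (D†D + s)⁻¹`** (3.2), `l = 1`. [cite: LuscherPalombi2008, eq. (3.2) (l = 1)] -/
noncomputable def rwExponent₁ (D : Matrix ι ι ℂ) (μ : ℝ) : ℝ :=
  ∫ s in (0 : ℝ)..μ ^ 2, ((tmKernel D 0 + (s : ℂ) • (1 : Matrix ι ι ℂ))⁻¹).trace.re

/-- **`X₂ = ∫₀^{μ²}∫₀^{μ²} ds₁ds₂ Tr (D†D + s₁ + s₂)⁻²`** (3.2), `l = 2`.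
[cite: LuscherPalombi2008, eq. (3.2) (l = 2)] -/
noncomputable def rwExponent₂ (D : Matrix ι ι ℂ) (μ : ℝ) : ℝ :=
  ∫ s₁ in (0 : ℝ)..μ ^ 2, ∫ s₂ in (0 : ℝ)..μ ^ 2,
    (((tmKernel D 0 + ((s₁ + s₂ : ℝ) : ℂ) • (1 : Matrix ι ι ℂ))⁻¹) ^ 2).trace.re

/-- Unfolding lemma for `rwExponent₁`. [cite: LuscherPalombi2008, eq. (3.2) (l = 1)] -/
theorem rwExponent₁_def (D : Matrix ι ι ℂ) (μ : ℝ) :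
    rwExponent₁ D μ = ∫ s in (0 : ℝ)..μ ^ 2, ((tmKernel D 0 + (s : ℂ) • (1 : Matrix ι ι ℂ))⁻¹).trace.re :=
  rfl

/-- Unfolding lemma for `rwExponent₂`. [cite: LuscherPalombi2008, eq. (3.2) (l = 2)] -/
theorem rwExponent₂_def (D : Matrix ι ι ℂ) (μ : ℝ) :
    rwExponent₂ D μ = ∫ s₁ in (0 : ℝ)..μ ^ 2, ∫ s₂ in (0 : ℝ)..μ ^ 2,
      (((tmKernel D 0 + ((s₁ + s₂ : ℝ) : ℂ) • (1 : Matrix ι ι ℂ))⁻¹) ^ 2).trace.re :=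
  rfl

/-- `∫₀^m (c + s)⁻¹ ds = log((c + m)/c)` for `c > 0`, `m ≥ 0` (private helper). [folklore] -/
private theorem integral_inv_const_add {c : ℝ} (hc : 0 < c) {m : ℝ} (hm : 0 ≤ m) :
    ∫ s in (0 : ℝ)..m, (c + s)⁻¹ = Real.log ((c + m) / c) := by
  have h := intervalIntegral.integral_comp_add_left (fun x : ℝ => x⁻¹) c (a := 0) (b := m)
  rw [h, add_zero]
  exact integral_inv (Set.notMem_uIcc_of_lt hc (by linarith))

/-- `∫₀^m (c + s)⁻² ds = c⁻¹ − (c + m)⁻¹` for `c > 0`, `m ≥ 0` (private helper). [folklore] -/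
private theorem integral_inv_const_add_sq {c : ℝ} (hc : 0 < c) {m : ℝ} (hm : 0 ≤ m) :
    ∫ s in (0 : ℝ)..m, (c + s)⁻¹ ^ 2 = c⁻¹ - (c + m)⁻¹ := by
  have h := intervalIntegral.integral_comp_add_left (fun x : ℝ => x ^ (-2 : ℤ)) c (a := 0) (b := m)
  have hpt : ∀ s : ℝ, (c + s)⁻¹ ^ 2 = (c + s) ^ (-2 : ℤ) := fun s => by
    rw [_root_.zpow_neg, zpow_ofNat, inv_pow]
  simp_rw [hpt]
  rw [h, add_zero, integral_zpow (Or.inr ⟨by norm_num, Set.notMem_uIcc_of_lt hc (by linarith)⟩)]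
  norm_num
  ring

/-- The eigenvalue shifts on the integration range are positive (private helper). [folklore] -/
private theorem spectrum_add_ne_zero (hD : IsUnit D.det) {s : ℝ} (hs : 0 ≤ s) :
    ∀ x ∈ spectrum ℝ (tmKernel D 0), x + s ≠ 0 := fun _ hx =>
  (add_pos_of_pos_of_nonneg (spectrum_pos_of_posDef (posDef_tmKernel_zero hD) hx) hs).ne'

/-- **`X₁ = Σᵢ log((λᵢ + μ²)/λᵢ)`** (invertible `D`): the `s`-integral of (3.2) done mode by mode.
[cite: LuscherPalombi2008, eq. (3.2) (l = 1)] -/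
theorem rwExponent₁_eq_sum_log (hD : IsUnit D.det) (μ : ℝ) :
    rwExponent₁ D μ = ∑ i, Real.log (((isHermitian_tmKernel D 0).eigenvalues i + μ ^ 2) /
      (isHermitian_tmKernel D 0).eigenvalues i) := by
  have hpos := eigenvalues_tmKernel_zero_pos hD
  have heq : Set.EqOn (fun s : ℝ => ((tmKernel D 0 + (s : ℂ) • (1 : Matrix ι ι ℂ))⁻¹).trace.re)
      (fun s => ∑ i, ((isHermitian_tmKernel D 0).eigenvalues i + s)⁻¹) (Set.uIcc 0 (μ ^ 2)) := by
    intro s hs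
    rw [Set.uIcc_of_le (sq_nonneg μ), Set.mem_Icc] at hs
    exact trace_inv_tmKernel_zero_add_re D (spectrum_add_ne_zero hD hs.1)
  rw [rwExponent₁, intervalIntegral.integral_congr heq, intervalIntegral.integral_finsetSum]
  · exact Finset.sum_congr rfl fun i _ => integral_inv_const_add (hpos i) (sq_nonneg μ)
  · intro i _
    refine ContinuousOn.intervalIntegrable ?_
    refine (continuousOn_const.add continuousOn_id).inv₀ fun s hs => ?_
    rw [Set.uIcc_of_le (sq_nonneg μ), Set.mem_Icc] at hs
    exact (add_pos_of_pos_of_nonneg (hpos i) hs.1).ne'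

/-- **(3.2) for `l = 1`: `W₁ = e^{−X₁}`** (invertible `D`). [cite: LuscherPalombi2008, eq. (3.2) (l = 1)] -/
theorem exp_neg_rwExponent₁ (hD : IsUnit D.det) (μ : ℝ) : Real.exp (-rwExponent₁ D μ) = rwFactor₁ D μ := by
  rw [rwExponent₁_eq_sum_log hD, ← Finset.sum_neg_distrib, Real.exp_sum, rwFactor₁_eq_prod]
  refine Finset.prod_congr rfl fun i _ => ?_
  have hl := eigenvalues_tmKernel_zero_pos hD i
  rw [← Real.log_inv, Real.exp_log (by positivity), inv_div, w₁]

/-- **`X₂ = Σᵢ [log((λᵢ + μ²)/λᵢ) − log((λᵢ + 2μ²)/(λᵢ + μ²))]`** (invertible `D`): the double `s`-integral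
of (3.2) done mode by mode (inner integral `∫₀^{μ²}(λ + s₁ + s₂)⁻² ds₂ = (λ + s₁)⁻¹ − (λ + s₁ + μ²)⁻¹`).
[cite: LuscherPalombi2008, eq. (3.2) (l = 2)] -/
theorem rwExponent₂_eq_sum_log (hD : IsUnit D.det) (μ : ℝ) :
    rwExponent₂ D μ = ∑ i, (Real.log (((isHermitian_tmKernel D 0).eigenvalues i + μ ^ 2) /
        (isHermitian_tmKernel D 0).eigenvalues i) -
      Real.log (((isHermitian_tmKernel D 0).eigenvalues i + μ ^ 2 + μ ^ 2) /
        ((isHermitian_tmKernel D 0).eigenvalues i + μ ^ 2))) := by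
  have hpos := eigenvalues_tmKernel_zero_pos hD
  set ev := (isHermitian_tmKernel D 0).eigenvalues with hev
  -- the inner integral, for `s₁ ∈ [0, μ²]`
  have hinner : Set.EqOn (fun s₁ : ℝ => ∫ s₂ in (0 : ℝ)..μ ^ 2,
        (((tmKernel D 0 + ((s₁ + s₂ : ℝ) : ℂ) • (1 : Matrix ι ι ℂ))⁻¹) ^ 2).trace.re)
      (fun s₁ => ∑ i, ((ev i + s₁)⁻¹ - (ev i + μ ^ 2 + s₁)⁻¹)) (Set.uIcc 0 (μ ^ 2)) := by
    intro s₁ hs₁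
    rw [Set.uIcc_of_le (sq_nonneg μ), Set.mem_Icc] at hs₁
    have heq : Set.EqOn (fun s₂ : ℝ =>
          (((tmKernel D 0 + ((s₁ + s₂ : ℝ) : ℂ) • (1 : Matrix ι ι ℂ))⁻¹) ^ 2).trace.re)
        (fun s₂ => ∑ i, (ev i + s₁ + s₂)⁻¹ ^ 2) (Set.uIcc 0 (μ ^ 2)) := by
      intro s₂ hs₂
      rw [Set.uIcc_of_le (sq_nonneg μ), Set.mem_Icc] at hs₂
      simp only
      rw [trace_inv_tmKernel_zero_add_sq_re D (spectrum_add_ne_zero hD (add_nonneg hs₁.1 hs₂.1))]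
      simp only [hev, add_assoc]
    simp only
    rw [intervalIntegral.integral_congr heq, intervalIntegral.integral_finsetSum]
    · refine Finset.sum_congr rfl fun i _ => ?_
      rw [integral_inv_const_add_sq (add_pos_of_pos_of_nonneg (hpos i) hs₁.1) (sq_nonneg μ)]
      ring_nf
    · intro i _
      refine ContinuousOn.intervalIntegrable ?_
      refine ((continuousOn_const.add continuousOn_id).inv₀ fun s hs => ?_).pow 2
      rw [Set.uIcc_of_le (sq_nonneg μ), Set.mem_Icc] at hs
      exact (add_pos_of_pos_of_nonneg (add_pos_of_pos_of_nonneg (hpos i) hs₁.1) hs.1).ne'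
  rw [rwExponent₂, intervalIntegral.integral_congr hinner, intervalIntegral.integral_finsetSum]
  · refine Finset.sum_congr rfl fun i _ => ?_
    have hc2 : 0 < ev i + μ ^ 2 := add_pos_of_pos_of_nonneg (hpos i) (sq_nonneg μ)
    rw [intervalIntegral.integral_sub, integral_inv_const_add (hpos i) (sq_nonneg μ),
      integral_inv_const_add hc2 (sq_nonneg μ)]
    · exact ((continuousOn_const.add continuousOn_id).inv₀ fun s hs => by
        rw [Set.uIcc_of_le (sq_nonneg μ), Set.mem_Icc] at hs
        exact (add_pos_of_pos_of_nonneg (hpos i) hs.1).ne').intervalIntegrable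
    · exact ((continuousOn_const.add continuousOn_id).inv₀ fun s hs => by
        rw [Set.uIcc_of_le (sq_nonneg μ), Set.mem_Icc] at hs
        exact (add_pos_of_pos_of_nonneg hc2 hs.1).ne').intervalIntegrable
  · intro i _
    refine ContinuousOn.intervalIntegrable (ContinuousOn.sub ?_ ?_)
    · exact (continuousOn_const.add continuousOn_id).inv₀ fun s hs => by
        rw [Set.uIcc_of_le (sq_nonneg μ), Set.mem_Icc] at hs
        exact (add_pos_of_pos_of_nonneg (hpos i) hs.1).ne'
    · exact (continuousOn_const.add continuousOn_id).inv₀ fun s hs => by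
        rw [Set.uIcc_of_le (sq_nonneg μ), Set.mem_Icc] at hs
        exact (add_pos_of_pos_of_nonneg (add_pos_of_pos_of_nonneg (hpos i) (sq_nonneg μ)) hs.1).ne'

/-- **(3.2) for `l = 2`: `W₂ = e^{−X₂}`** (invertible `D`). [cite: LuscherPalombi2008, eq. (3.2) (l = 2)] -/
theorem exp_neg_rwExponent₂ (hD : IsUnit D.det) (μ : ℝ) : Real.exp (-rwExponent₂ D μ) = rwFactor₂ D μ := by
  rw [rwExponent₂_eq_sum_log hD, ← Finset.sum_neg_distrib, Real.exp_sum, rwFactor₂_eq_prod]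
  refine Finset.prod_congr rfl fun i _ => ?_
  have hl := eigenvalues_tmKernel_zero_pos hD i
  have h1 : 0 < (isHermitian_tmKernel D 0).eigenvalues i + μ ^ 2 := by positivity
  have h2 : 0 < (isHermitian_tmKernel D 0).eigenvalues i + μ ^ 2 + μ ^ 2 := by positivity
  rw [neg_sub, Real.exp_sub, Real.exp_log (by positivity), Real.exp_log (by positivity), w₂]
  field_simp
  ring

end IntegralRepresentation

end Literature.MathematicalPhysics.QuantumLattice.TwistedMass
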